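import Literature.NumberTheory.EllipticCurves.PlusMinusPAdicLFunction
import Literature.NumberTheory.EllipticCurves.PAdicLFunctionIntegralityProofs
import Literature.NumberTheory.EllipticCurves.PAdicLFunctionNeZeroProofs
import Literature.NumberTheory.EllipticCurves.PAdicLFunctionProofs
import Literature.NumberTheory.EllipticCurves.PAdicLFunctionDistributionHoldsProofs
import Literature.NumberTheory.EllipticCurves.RohrlichNonvanishingRankinProofs
import Literature.NumberTheory.EllipticCurves.ModularSymbolsEichlerShimuraHoldsProofs
import HarnessLib

/-!
# Pollack's plus/minus `p`-adic `L`-functions exist — proof of the named fact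
# `pollack_exists_plusMinusPAdicLFunction` (Pollack 2003, Thm. 5.6, Cor. 5.11, Prop. 6.18)

Topic `NumberTheory/EllipticCurves`; `Proofs` companion (theorems only, no new definition, no new
named fact) of `Literature.NumberTheory.EllipticCurves.PlusMinusPAdicLFunction`, whose named fact
`Literature.NumberTheory.EllipticCurves.pollack_exists_plusMinusPAdicLFunction` — for `p` odd,
`f` the newform of `E = W`, `E` with good reduction at `p` and `a_p(E) = 0`, there are
`L⁺, L⁻ ∈ Λ = ℤ_p⟦T⟧`, both `≠ 0`, with `θ_n ≡ (-1)^{⌊n/2⌋+1} ω_n^+ L⁺ (mod ω_n)` for odd `n` and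
`θ_n ≡ (-1)^{⌊n/2⌋+1} ω_n^- L⁻ (mod ω_n)` for even `n` (congruences in `Λ ⊗ ℚ_p`) — is PROVED
here: `pollack_exists_plusMinusPAdicLFunction_holds`.

## The printed result and the route taken

Pollack (Duke Math. J. 118 (2003)) constructs `L_p^±` ANALYTICALLY (Thm. 5.6:
`L_p(E, α, T) = L⁺ log⁺ + L⁻ log⁻ α` with the half-logarithms of §4), proves `L^± ≠ 0` from
Rohrlich's theorem (Cor. 5.11) and then the congruences with the Mazur–Tate elements (Prop. 6.18).
The tree has no supersingular `L_p(E, α, T)` (see the design notes of `PAdicLFunction.lean` and of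
`PlusMinusPAdicLFunction.lean`), so we run the argument BACKWARDS, entirely inside `Λ`, which is
the folklore algebraic reconstruction of `L^±` from the modular elements (cf. Kurihara, Invent.
Math. 149 (2002); Kobayashi, Invent. Math. 152 (2003) Thm. 3.2 and (3.4)–(3.5); C.-H. Kim–Kurihara,
IMRN (2021), Prop. 1.11 [corpus: paper:arxiv-1804.00418 p. 5]: "`θ_n(f) ≡ ω_n^± · L_p^±
(mod ω_n)` in `Λ_n`"):

1. (§3, `cyclotomicOmega_dvd_mazurTateElement_add`) **the three-term relation** of Mazur–Tate
   (Mazur–Tate–Teitelbaum 1986 §I.10 (10.2); Mazur–Tate 1987 (1.3)) at `a_p = 0`: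
   `θ_{n+2} ≡ −Φ_{p^{n+1}}(1+T) · θ_n (mod ω_{n+1})` in `ℚ[T]`, from the Hecke relation
   `∑_{j<p} [(r+j)/p]⁺ = a_p[r]⁺ − [pr]⁺ = −[pr]⁺` (`intCast_mul_ratPlusSymbol`, PROVED in the tree)
   summed over the fibres of `(ℤ/p^{n+2+e₀})^× → (ℤ/p^{n+1+e₀})^×`, which are the orbits of
   `γ^{p^{n+1}}` (`orderOf_cyclotomicGenerator`);
2. (§5) hence `ω⁻_{2m} ∣ θ_{2m}`, `ω⁺_{2m+1} ∣ θ_{2m+1}`, and the signed quotients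
   `(-1)^{m+1} θ_{2m}/ω⁻_{2m}` (resp. `(-1)^{m+1} θ_{2m+1}/ω⁺_{2m+1}`) are compatible modulo
   `T ω⁺_{2m}` (resp. `T ω⁻_{2m+1}`) — the sign `(-1)^{⌊n/2⌋+1}` is exactly what makes them
   compatible;
3. (§7) the symbols `[a/p^k]⁺_f` are `p`-INTEGRAL at an odd prime with `a_p = 0`
   (`norm_ratPlusSymbol_le_one` of `PAdicLFunctionIntegralityProofs` with the Eisenstein number
   `a_p − p − 1 = −(p+1)`, a `p`-adic unit — no hypothesis on `E[p]`), so everything descends to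
   `ℤ_p[T]` (monic division commutes with base change);
4. (§6) `Λ` is complete along the tower `T ω^±_{n}` (coefficientwise `p`-adic convergence: the
   differences lie in `T · (p, T)^m` since `Φ_{p^k}(1) = p`), giving `L⁻, L⁺ ∈ Λ` with
   `θ_n − (-1)^{⌊n/2⌋+1} ω_n^∓ L^∓ ∈ ω_n Λ` (§8; we even get the congruence integrally, exponent
   `m = 0` in `IsCongrModOmega`);
5. (§9) `L^± ≠ 0`: otherwise the congruences, evaluated at `χ(γ) − 1`
   (`IsCongrModOmega.eval₂_eq`, `eval₂_mazurTateElement_eq_ratTwistedSymbolSum`), kill the Birch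
   sums `∑ χ(a)[a/p^{n+1}]⁺ = τ(χ) L(E, χ̄, 1)/Ω⁺_f` for all wild `χ` of conductor `p^{n+1}` with `n`
   of one parity — infinitely many vanishing twists, contradicting Rohrlich's theorem, which is
   PROVED in the tree (`Rohrlich1984_nonvanishing_twists_holds`); this is Pollack's Cor. 5.11 run
   through the argument of `padicLFunction_ne_zero_of_rohrlich`.

Everything used is a theorem of Mathlib or of the tree (`ratCast_ratPlusSymbol_holds`,
`isZLattice_periodLattice_holds`, `exists_nsmul_modularSymbol_mem_periodLattice_of_isNewformOf`,
`exists_differentiable_eq_twistedLSeries_holds`, `cuspCoeff_eq_frobeniusTrace_of_isNewformOf_holds`,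
`not_dvd_level_of_isNewformOf`); no named fact is assumed. Net debt: −1.

## References

* R. Pollack, *On the `p`-adic `L`-function of a modular form at a supersingular prime*, Duke
  Math. J. 118 (2003), 523–558: Thm. 5.6, Cor. 5.11, §6.5, Prop. 6.18 [Pollack2003].
* S. Kobayashi, *Iwasawa theory for elliptic curves at supersingular primes*, Invent. Math. 152
  (2003), 1–36: Thm. 3.2, (3.4)–(3.6) [corpus: paper:doi-10-1007-s00222-002-0265-4 pp. 6–7]
  [Kobayashi2003].
* B. Mazur, J. Tate, J. Teitelbaum, Invent. Math. 84 (1986), §I.4 (4.2), §I.10 (10.2)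
  [MazurTateTeitelbaum1986Invent].
* D. E. Rohrlich, Invent. Math. 75 (1984), Theorem p. 409 [RohrlichInventiones1984].
* L. C. Washington, *Introduction to Cyclotomic Fields*, 2nd ed., §7.1–7.2 (`Λ ≅ lim ℤ_p[T]/(ω_n)`).

## Design

Theorems only, `namespace Literature.NumberTheory.EllipticCurves`; private helpers for reindexing,
limits and descent; axioms of every theorem: `propext`, `Classical.choice`, `Quot.sound`.
-/

noncomputable section

open scoped MatrixGroups ModularForm

open CongruenceSubgroup Polynomial Literature.NumberTheory.EllipticCurves.ModularForms

namespace Literature.NumberTheory.EllipticCurves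

/-! ## §1. Reindexing finite sums -/

section Reindex

variable {M : Type*} [AddCommMonoid M]

/-- Reindexing a sum over `ℤ/m` by the representatives `0 ≤ a.val < m`. [folklore] -/
private theorem sum_univ_zmod_val (m : ℕ) [NeZero m] (g : ℕ → M) :
    ∑ a : ZMod m, g a.val = ∑ k ∈ Finset.range m, g k := by
  refine Finset.sum_bij (fun a _ ↦ a.val) (fun a _ ↦ Finset.mem_range.mpr (ZMod.val_lt a))
    (fun a _ b _ h ↦ ZMod.val_injective m h) (fun k hk ↦ ?_) (fun _ _ ↦ rfl)
  exact ⟨(k : ZMod m), Finset.mem_univ _, ZMod.val_cast_of_lt (Finset.mem_range.mp hk)⟩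

/-- `∑_{k < a·b} g(k) = ∑_{j < a} ∑_{t < b} g(t + b·j)` (Euclidean division by `b`). [folklore] -/
private theorem sum_range_mul_eq_sum_sum (a b : ℕ) (g : ℕ → M) :
    ∑ k ∈ Finset.range (a * b), g k =
      ∑ j ∈ Finset.range a, ∑ t ∈ Finset.range b, g (t + b * j) := by
  rw [← Fin.sum_univ_eq_sum_range g (a * b),
    ← finProdFinEquiv.sum_comp (fun x : Fin (a * b) ↦ g x), Fintype.sum_prod_type,
    ← Fin.sum_univ_eq_sum_range (fun j ↦ ∑ t ∈ Finset.range b, g (t + b * j)) a]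
  refine Finset.sum_congr rfl fun j _ ↦ ?_
  rw [← Fin.sum_univ_eq_sum_range (fun t ↦ g (t + b * j)) b]
  refine Finset.sum_congr rfl fun t _ ↦ ?_
  rw [finProdFinEquiv_apply_val]

end Reindex

/-! ## §2. The Hecke relation at `p` with `a_p = 0` along the fibres of `ℤ/p^{L+1} → ℤ/p^L` -/

section Fiber

variable {N : ℕ} [NeZero N] {f : CuspForm (Gamma0 N) 2} {p : ℕ} [Fact p.Prime]

/-- **The Hecke relation at `p` with `a_p = 0`**: for the rational newform `f` (`IsNewform0`,
rational coefficients), `p ∤ N` and `a_p(f) = 0`, `∑_{j<p} [(r + j)/p]⁺_f = −[p r]⁺_f` for every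
`r ∈ ℚ` (`intCast_mul_ratPlusSymbol`, Mazur–Tate–Teitelbaum 1986 §I.4 (4.2); a private copy of
`Kobayashi2003.sum_range_ratPlusSymbol_div_eq`, kept local so that Pollack's construction does not
import the signed-Selmer vocabulary). [cite: MazurTateTeitelbaum1986Invent, §I.4 (4.2)] -/
private theorem sum_range_ratPlusSymbol_div_eq_neg (hf0 : IsNewform0 f) (hQ : coeffField f = ⊥)
    (hpN : ¬ p ∣ N) (hap : cuspCoeff f p = ((0 : ℤ) : ℂ)) (r : ℚ) :
    ∑ j ∈ Finset.range p, ratPlusSymbol f ((r + j) / p) = -ratPlusSymbol f (p * r) := by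
  have hp : p.Prime := Fact.out
  have h := intCast_mul_ratPlusSymbol p hf0 hp hpN hap
    (fun r ↦ ratCast_ratPlusSymbol_holds hf0 hQ r) r
  rw [Int.cast_zero, zero_mul, Fin.sum_univ_eq_sum_range (fun j ↦ ratPlusSymbol f ((r + j) / p)) p]
    at h
  linarith

/-- **The fibre sum at `a_p = 0`**: for `a mod p^L`, summing `[b/p^{L+1}]⁺_f` over the `p` lifts
`b` of `a` to `ℤ/p^{L+1}` gives `−[p · a/p^L]⁺_f = −[a/p^{L-1}]⁺_f`: the lifts are `a + p^L j`,
`j < p` (`filter_castHom_eq_image`), `(a + p^L j)/p^{L+1} = (a/p^L + j)/p`, and the Hecke relation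
with `a_p = 0` (`sum_range_ratPlusSymbol_div_eq_neg`) (Mazur–Tate–Teitelbaum 1986, §I.10 (10.2):
the distribution relation `π_{L+1/L} θ_{L+1} = a_p θ_L − ν θ_{L-1}`).
[cite: MazurTateTeitelbaum1986Invent, §I.10 Prop. (10.2)] -/
theorem sum_fiber_ratPlusSymbol_eq_neg_of_ap_zero (hf0 : IsNewform0 f) (hQ : coeffField f = ⊥)
    (hpN : ¬ p ∣ N) (hap : cuspCoeff f p = ((0 : ℤ) : ℂ)) {L L' : ℕ} (hL : L' = L + 1)
    (hdvd : p ^ L ∣ p ^ L') (a : ZMod (p ^ L)) :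
    ∑ b ∈ Finset.univ.filter (fun b : ZMod (p ^ L') ↦ ZMod.castHom hdvd (ZMod (p ^ L)) b = a),
        ratPlusSymbol f ((b.val : ℚ) / (p : ℚ) ^ L') =
      -ratPlusSymbol f (p * ((a.val : ℚ) / (p : ℚ) ^ L)) := by
  classical
  subst hL
  have hp : p.Prime := Fact.out
  haveI : NeZero p := ⟨hp.ne_zero⟩
  have hp0 : (p : ℚ) ≠ 0 := Nat.cast_ne_zero.mpr hp.ne_zero
  have hinj : Function.Injective
      (fun j : Fin p ↦ ((a.val + p ^ L * (j : ℕ) : ℕ) : ZMod (p ^ (L + 1)))) := by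
    intro j j' h
    have hv := congr_arg ZMod.val h
    simp only [val_classLift] at hv
    exact Fin.ext (Nat.eq_of_mul_eq_mul_left (pow_pos hp.pos L) (by omega))
  rw [filter_castHom_eq_image, Finset.sum_image fun j _ j' _ h ↦ hinj h]
  set x : ℚ := (a.val : ℚ) / (p : ℚ) ^ L with hx
  have hA : ∀ j : Fin p,
      ((a.val + p ^ L * (j : ℕ) : ℕ) : ℚ) / (p : ℚ) ^ (L + 1) = (x + j) / p := by
    intro j
    rw [hx]
    push_cast
    field_simp
    ring
  have hH := sum_range_ratPlusSymbol_div_eq_neg hf0 hQ hpN hap x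
  rw [← Fin.sum_univ_eq_sum_range (fun j ↦ ratPlusSymbol f ((x + j) / p)) p] at hH
  rw [← hH]
  refine Finset.sum_congr rfl fun j _ ↦ ?_
  rw [val_classLift, hA]

/-- The fibre of `ℤ/p^{L+1} → ℤ/p^L` over any class has exactly `p` elements. [folklore] -/
private theorem card_filter_castHom_eq {L L' : ℕ} (hL : L' = L + 1) (hdvd : p ^ L ∣ p ^ L')
    (a : ZMod (p ^ L)) :
    (Finset.univ.filter (fun b : ZMod (p ^ L') ↦ ZMod.castHom hdvd (ZMod (p ^ L)) b = a)).card
      = p := by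
  classical
  subst hL
  have hp : p.Prime := Fact.out
  have hinj : Function.Injective
      (fun j : Fin p ↦ ((a.val + p ^ L * (j : ℕ) : ℕ) : ZMod (p ^ (L + 1)))) := by
    intro j j' h
    have hv := congr_arg ZMod.val h
    simp only [val_classLift] at hv
    exact Fin.ext (Nat.eq_of_mul_eq_mul_left (pow_pos hp.pos L) (by omega))
  rw [filter_castHom_eq_image, Finset.card_image_of_injective _ hinj, Finset.card_univ,
    Fintype.card_fin]

/-- **An orbit of `δ = γ^{p^{m}}` is a fibre.** Let `b₀` be a unit of `ℤ/p^{L+1}` and `δ` an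
element of order `p` reducing to `1` modulo `p^L`; then `{b₀ δ^j : j < p}` is exactly the fibre of
`ℤ/p^{L+1} → ℤ/p^L` over `b₀ mod p^L` (both have `p` elements). [folklore] -/
private theorem image_mul_pow_eq_filter {L L' : ℕ} (hL : L' = L + 1) (hdvd : p ^ L ∣ p ^ L')
    {b₀ δ : ZMod (p ^ L')} (hb₀ : IsUnit b₀) (hδ : orderOf δ = p)
    (hδ1 : ZMod.castHom hdvd (ZMod (p ^ L)) δ = 1) :
    Finset.univ.image (fun j : Fin p ↦ b₀ * δ ^ (j : ℕ)) =
      Finset.univ.filter (fun b : ZMod (p ^ L') ↦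
        ZMod.castHom hdvd (ZMod (p ^ L)) b = ZMod.castHom hdvd (ZMod (p ^ L)) b₀) := by
  classical
  have hinj : Function.Injective (fun j : Fin p ↦ b₀ * δ ^ (j : ℕ)) := by
    intro j j' h
    have h1 : δ ^ (j : ℕ) = δ ^ (j' : ℕ) := hb₀.mul_right_inj.mp h
    have h2 := pow_injOn_Iio_orderOf (x := δ) (by rw [hδ]; exact j.2) (by rw [hδ]; exact j'.2) h1
    exact Fin.ext h2
  refine Finset.eq_of_subset_of_card_le (fun b hb ↦ ?_) ?_
  · obtain ⟨j, -, rfl⟩ := Finset.mem_image.mp hb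
    simp only [Finset.mem_filter, Finset.mem_univ, true_and, map_mul, map_pow, hδ1, one_pow,
      mul_one]
  · rw [card_filter_castHom_eq hL hdvd, Finset.card_image_of_injective _ hinj, Finset.card_univ,
      Fintype.card_fin]

/-- **Orbit form of the fibre sum**: with `b₀`, `δ` as in `image_mul_pow_eq_filter`,
`∑_{j<p} [b₀δ^j / p^{L+1}]⁺_f = −[p · (b₀ mod p^L)/p^L]⁺_f` (`a_p = 0`). [folklore] -/
private theorem sum_range_ratPlusSymbol_orbit_eq_neg (hf0 : IsNewform0 f) (hQ : coeffField f = ⊥)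
    (hpN : ¬ p ∣ N) (hap : cuspCoeff f p = ((0 : ℤ) : ℂ)) {L L' : ℕ} (hL : L' = L + 1)
    (hdvd : p ^ L ∣ p ^ L') {b₀ δ : ZMod (p ^ L')} (hb₀ : IsUnit b₀) (hδ : orderOf δ = p)
    (hδ1 : ZMod.castHom hdvd (ZMod (p ^ L)) δ = 1) :
    ∑ j ∈ Finset.range p, ratPlusSymbol f (((b₀ * δ ^ j).val : ℚ) / (p : ℚ) ^ L') =
      -ratPlusSymbol f
        (p * (((ZMod.castHom hdvd (ZMod (p ^ L)) b₀).val : ℚ) / (p : ℚ) ^ L)) := by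
  classical
  have hinj : Function.Injective (fun j : Fin p ↦ b₀ * δ ^ (j : ℕ)) := by
    intro j j' h
    have h1 : δ ^ (j : ℕ) = δ ^ (j' : ℕ) := hb₀.mul_right_inj.mp h
    have h2 := pow_injOn_Iio_orderOf (x := δ) (by rw [hδ]; exact j.2) (by rw [hδ]; exact j'.2) h1
    exact Fin.ext h2
  rw [← sum_fiber_ratPlusSymbol_eq_neg_of_ap_zero hf0 hQ hpN hap hL hdvd, ← image_mul_pow_eq_filter hL hdvd
    hb₀ hδ hδ1, Finset.sum_image fun j _ j' _ h ↦ hinj h,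
    ← Fin.sum_univ_eq_sum_range (fun j ↦ ratPlusSymbol f (((b₀ * δ ^ j).val : ℚ) / (p : ℚ) ^ L')) p]

/-- `[p · x/p^{S+1}]⁺_f = [(x mod p^S)/p^S]⁺_f` for `x mod p^{S+1}`: `p·x/p^{S+1} = x/p^S` differs
from `(x mod p^S)/p^S` by an integer (`ratPlusSymbol_add_intCast_eq`). [folklore] -/
private theorem ratPlusSymbol_mul_div_pow_eq {S I : ℕ} (hI : I = S + 1) (hdvd : p ^ S ∣ p ^ I)
    (x : ZMod (p ^ I)) :
    ratPlusSymbol f (p * ((x.val : ℚ) / (p : ℚ) ^ I)) =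
      ratPlusSymbol f (((ZMod.castHom hdvd (ZMod (p ^ S)) x).val : ℚ) / (p : ℚ) ^ S) := by
  subst hI
  have hp : p.Prime := Fact.out
  haveI : NeZero (p ^ S) := ⟨pow_ne_zero _ hp.ne_zero⟩
  have hp0 : (p : ℚ) ≠ 0 := Nat.cast_ne_zero.mpr hp.ne_zero
  have hval : (ZMod.castHom hdvd (ZMod (p ^ S)) x).val = x.val % p ^ S := by
    rw [ZMod.castHom_apply, ZMod.cast_eq_val, ZMod.val_natCast]
  set q : ℕ := x.val / p ^ S with hq
  set r : ℕ := x.val % p ^ S with hr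
  have hx : (x.val : ℚ) = (r : ℚ) + (p : ℚ) ^ S * (q : ℚ) := by
    rw [hr, hq]
    exact_mod_cast (Nat.mod_add_div x.val (p ^ S)).symm
  have heq : (p : ℚ) * ((x.val : ℚ) / (p : ℚ) ^ (S + 1)) =
      (r : ℚ) / (p : ℚ) ^ S + ((q : ℤ) : ℚ) := by
    rw [hx, Int.cast_natCast, pow_succ]
    field_simp
  rw [heq, ratPlusSymbol_add_intCast_eq, hval]

end Fiber

/-! ## §3. The three-term relation `θ_{n+2} ≡ −Φ_{p^{n+1}}(1+T) · θ_n (mod ω_{n+1})` -/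

section ThreeTerm

variable {N : ℕ} [NeZero N] {f : CuspForm (Gamma0 N) 2} {p : ℕ} [Fact p.Prime]

omit [NeZero N] in
/-- The image of `θ_m` under a ring homomorphism `φ : ℚ[T] → R`:
`φ(θ_m) = ∑_η ∑_{k < p^m} φ([η γ^k / p^{m+e₀}]⁺) · φ(1+T)^k`. [folklore] -/
private theorem map_mazurTateElement_eq {R : Type*} [CommRing R] (φ : ℚ[X] →+* R) (m : ℕ)
    [Fintype (rootsOfUnity (torsionOrder p) ℤ_[p])] :
    φ (mazurTateElement f p m) =
      ∑ w : rootsOfUnity (torsionOrder p) ℤ_[p], ∑ k ∈ Finset.range (p ^ m),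
        φ (C (ratPlusSymbol f
          (((PadicInt.toZModPow (m + cyclotomicExponent p) ((w : ℤ_[p]ˣ) : ℤ_[p]) *
              (cyclotomicGenerator p : ZMod (p ^ (m + cyclotomicExponent p))) ^ k).val : ℚ) /
            (p : ℚ) ^ (m + cyclotomicExponent p)))) * φ (X + 1) ^ k := by
  classical
  haveI : NeZero (p ^ m) := ⟨pow_ne_zero _ (Fact.out : p.Prime).ne_zero⟩
  rw [mazurTateElement, finsum_eq_sum_of_fintype, map_sum]
  refine Finset.sum_congr rfl fun w _ ↦ ?_
  rw [map_sum, ← sum_univ_zmod_val (p ^ m) (fun k ↦ φ (C (ratPlusSymbol f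
          (((PadicInt.toZModPow (m + cyclotomicExponent p) ((w : ℤ_[p]ˣ) : ℤ_[p]) *
              (cyclotomicGenerator p : ZMod (p ^ (m + cyclotomicExponent p))) ^ k).val : ℚ) /
            (p : ℚ) ^ (m + cyclotomicExponent p)))) * φ (X + 1) ^ k)]
  refine Finset.sum_congr rfl fun s _ ↦ ?_
  rw [map_mul, map_pow]

/-- **The three-term relation of the Mazur–Tate elements at `a_p = 0`**
(Mazur–Tate 1987, (1.3); Mazur–Tate–Teitelbaum 1986, §I.10: `π_{n+2/n+1}(θ_{n+2}) =
a_p θ_{n+1} − ν_{n/n+1}(θ_n)`; with `a_p = 0` and `ν_{n/n+1} =` multiplication by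
`Φ_{p^{n+1}}(1+T) = ω_{n+1}/ω_n`): in `ℚ[T]`,
`ω_{n+1} ∣ θ_{n+2} + Φ_{p^{n+1}}(1+T) · θ_n`.
Proof: in `ℚ[T]/(ω_{n+1})`, where `u = 1 + T` has `u^{p^{n+1}} = 1`, write `k < p^{n+2}` as
`k = t + p^{n+1} j`; the classes `η γ^t · (γ^{p^{n+1}})^j`, `j < p`, form the fibre of
`ℤ/p^{n+2+e₀} → ℤ/p^{n+1+e₀}` over `η γ^t` (`γ^{p^{n+1}}` has order `p` modulo `p^{n+2+e₀}` and is
`≡ 1 (mod p^{n+1+e₀})`, `orderOf_cyclotomicGenerator`), so the Hecke relation with `a_p = 0` sums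
them to `−[η γ^t/p^{n+e₀}]⁺` (`sum_range_ratPlusSymbol_orbit_eq_neg`); then `t = t' + p^n k`
collects `∑_{k<p} u^{p^n k} = Φ_{p^{n+1}}(u)`. [cite: MazurTateTeitelbaum1986Invent, §I.10 Prop. (10.2)] -/
theorem cyclotomicOmega_dvd_mazurTateElement_add (hf0 : IsNewform0 f) (hQ : coeffField f = ⊥)
    (hpN : ¬ p ∣ N) (hap : cuspCoeff f p = ((0 : ℤ) : ℂ)) (n : ℕ) :
    (cyclotomicOmega p (n + 1)).map (Int.castRingHom ℚ) ∣
      mazurTateElement f p (n + 2) +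
        ((cyclotomic (p ^ (n + 1)) ℤ).comp (X + 1)).map (Int.castRingHom ℚ) *
          mazurTateElement f p n := by
  classical
  have hp : p.Prime := Fact.out
  haveI := neZero_torsionOrder p
  haveI := Fintype.ofFinite (rootsOfUnity (torsionOrder p) ℤ_[p])
  -- the three levels `S = n + e₀ < I = n + 1 + e₀ < B = n + 2 + e₀`
  have hIS : n + 1 + (cyclotomicExponent p) = (n + (cyclotomicExponent p)) + 1 := by omega
  have hBI : n + 2 + (cyclotomicExponent p) = (n + 1 + (cyclotomicExponent p)) + 1 := by omega
  have hdvdIS : p ^ (n + (cyclotomicExponent p)) ∣ p ^ (n + 1 + (cyclotomicExponent p)) := pow_dvd_pow p (by omega)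
  have hdvdBI : p ^ (n + 1 + (cyclotomicExponent p)) ∣ p ^ (n + 2 + (cyclotomicExponent p)) := pow_dvd_pow p (by omega)
  -- the quotient ring `ℚ[T]/(ω_{n+1})` and `u = 1 + T`
  set ωQ : ℚ[X] := (cyclotomicOmega p (n + 1)).map (Int.castRingHom ℚ) with hωQ
  rw [← AdjoinRoot.mk_eq_zero]
  set π : ℚ[X] →+* AdjoinRoot ωQ := AdjoinRoot.mk ωQ with hπ
  set u : AdjoinRoot ωQ := π (X + 1) with hu
  have hu1 : u ^ p ^ (n + 1) = 1 := by
    have hω : ((X : ℚ[X]) + 1) ^ p ^ (n + 1) - 1 = ωQ := by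
      rw [hωQ, cyclotomicOmega, Polynomial.map_sub, Polynomial.map_pow, Polynomial.map_add,
        Polynomial.map_X, Polynomial.map_one]
    have h0 : π (((X : ℚ[X]) + 1) ^ p ^ (n + 1) - 1) = 0 := by
      rw [hω]
      exact AdjoinRoot.mk_self
    rw [map_sub, map_pow, map_one, sub_eq_zero] at h0
    rw [hu, h0]
  have hupow : ∀ a b : ℕ, u ^ (a + p ^ (n + 1) * b) = u ^ a := fun a b ↦ by
    rw [pow_add, pow_mul, hu1, one_pow, mul_one]
  -- `γ` at the three levels
  have hγS : (cyclotomicGenerator p : ZMod (p ^ (n + (cyclotomicExponent p)))) ^ p ^ n = 1 := by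
    rw [← orderOf_cyclotomicGenerator p n, pow_orderOf_eq_one]
  have hγI : (cyclotomicGenerator p : ZMod (p ^ (n + 1 + (cyclotomicExponent p)))) ^ p ^ (n + 1) = 1 := by
    rw [← orderOf_cyclotomicGenerator p (n + 1), pow_orderOf_eq_one]
  have hδord : orderOf ((cyclotomicGenerator p : ZMod (p ^ (n + 2 + (cyclotomicExponent p)))) ^ p ^ (n + 1)) = p := by
    rw [orderOf_pow' _ (pow_ne_zero _ hp.ne_zero), orderOf_cyclotomicGenerator p (n + 2),
      Nat.gcd_eq_right (pow_dvd_pow p (by omega : n + 1 ≤ n + 2)), Nat.pow_div (by omega) hp.pos,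
      show n + 2 - (n + 1) = 1 by omega, pow_one]
  have hδ1 : ZMod.castHom hdvdBI (ZMod (p ^ (n + 1 + (cyclotomicExponent p))))
      ((cyclotomicGenerator p : ZMod (p ^ (n + 2 + (cyclotomicExponent p)))) ^ p ^ (n + 1)) = 1 := by
    rw [map_pow, map_natCast, hγI]
  have hpdiv : ∀ v : ℚ, (p : ℚ) * (v / (p : ℚ) ^ (n + 1 + (cyclotomicExponent p))) = v / (p : ℚ) ^ (n + (cyclotomicExponent p)) := by
    intro v
    have hp0 : (p : ℚ) ≠ 0 := Nat.cast_ne_zero.mpr hp.ne_zero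
    rw [hIS, pow_succ]
    field_simp
  -- the common value `T = ∑_η ∑_{k<p} ∑_{t'<p^n} [η γ^{t'}/p^{n+e₀}]⁺ u^{t'} (u^{p^n})^k`
  set A : rootsOfUnity (torsionOrder p) ℤ_[p] → ℕ → ℚ := fun w k ↦ ratPlusSymbol f
    (((PadicInt.toZModPow (n + (cyclotomicExponent p)) ((w : ℤ_[p]ˣ) : ℤ_[p]) *
        (cyclotomicGenerator p : ZMod (p ^ (n + (cyclotomicExponent p)))) ^ k).val : ℚ) / (p : ℚ) ^ (n + (cyclotomicExponent p))) with hA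
  set T : AdjoinRoot ωQ := ∑ w : rootsOfUnity (torsionOrder p) ℤ_[p], ∑ k ∈ Finset.range p,
    ∑ t ∈ Finset.range (p ^ n), π (C (A w t)) * (u ^ t * (u ^ p ^ n) ^ k) with hT
  -- `π(θ_n)` and `π(Φ_{p^{n+1}}(1+T))`
  have hθn : π (mazurTateElement f p n) =
      ∑ w : rootsOfUnity (torsionOrder p) ℤ_[p], ∑ t ∈ Finset.range (p ^ n),
        π (C (A w t)) * u ^ t := by
    rw [map_mazurTateElement_eq π n]
  have hξ : π (((cyclotomic (p ^ (n + 1)) ℤ).comp (X + 1)).map (Int.castRingHom ℚ)) =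
      ∑ k ∈ Finset.range p, (u ^ p ^ n) ^ k := by
    rw [cyclotomic_prime_pow_eq_geom_sum hp, Polynomial.sum_comp, Polynomial.map_sum, map_sum]
    refine Finset.sum_congr rfl fun k _ ↦ ?_
    rw [pow_comp, pow_comp, X_comp, Polynomial.map_pow, Polynomial.map_pow, Polynomial.map_add,
      Polynomial.map_X, Polynomial.map_one, map_pow, map_pow]
  have hRHS : π (((cyclotomic (p ^ (n + 1)) ℤ).comp (X + 1)).map (Int.castRingHom ℚ)) *
      π (mazurTateElement f p n) = T := by
    rw [hξ, hθn, Finset.mul_sum]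
    refine Finset.sum_congr rfl fun w _ ↦ ?_
    rw [Finset.sum_mul]
    refine Finset.sum_congr rfl fun k _ ↦ ?_
    rw [Finset.mul_sum]
    refine Finset.sum_congr rfl fun t _ ↦ ?_
    ring
  -- `π(θ_{n+2}) = -T`
  have hLHS : π (mazurTateElement f p (n + 2)) = -T := by
    rw [map_mazurTateElement_eq π (n + 2), ← hu]
    -- Step 1: `k = t + p^{n+1} j`, the `j`-sum is an orbit sum
    have h1 : ∀ w : rootsOfUnity (torsionOrder p) ℤ_[p],
        ∑ k ∈ Finset.range (p ^ (n + 2)),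
          π (C (ratPlusSymbol f
            (((PadicInt.toZModPow (n + 2 + (cyclotomicExponent p)) ((w : ℤ_[p]ˣ) : ℤ_[p]) *
                (cyclotomicGenerator p : ZMod (p ^ (n + 2 + (cyclotomicExponent p)))) ^ k).val : ℚ) /
              (p : ℚ) ^ (n + 2 + (cyclotomicExponent p))))) * u ^ k =
        -∑ t ∈ Finset.range (p ^ (n + 1)),
          π (C (ratPlusSymbol f
            (((PadicInt.toZModPow (n + 1 + (cyclotomicExponent p)) ((w : ℤ_[p]ˣ) : ℤ_[p]) *
                (cyclotomicGenerator p : ZMod (p ^ (n + 1 + (cyclotomicExponent p)))) ^ t).val : ℚ) /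
              (p : ℚ) ^ (n + (cyclotomicExponent p))))) * u ^ t := by
      intro w
      rw [show p ^ (n + 2) = p * p ^ (n + 1) by ring, sum_range_mul_eq_sum_sum, Finset.sum_comm,
        ← Finset.sum_neg_distrib]
      refine Finset.sum_congr rfl fun t _ ↦ ?_
      simp_rw [hupow t]
      rw [← Finset.sum_mul, ← map_sum, ← map_sum, ← neg_mul, ← map_neg, ← C_neg]
      congr 3
      -- the orbit sum
      set b₀ : ZMod (p ^ (n + 2 + (cyclotomicExponent p))) := PadicInt.toZModPow (n + 2 + (cyclotomicExponent p)) ((w : ℤ_[p]ˣ) : ℤ_[p]) *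
        (cyclotomicGenerator p : ZMod (p ^ (n + 2 + (cyclotomicExponent p)))) ^ t with hb₀
      have hb₀u : IsUnit b₀ :=
        ((Units.isUnit _).map _).mul ((isUnit_cyclotomicGenerator_cast p _).pow _)
      have horb := sum_range_ratPlusSymbol_orbit_eq_neg hf0 hQ hpN hap hBI hdvdBI hb₀u hδord hδ1
      have hcast : ZMod.castHom hdvdBI (ZMod (p ^ (n + 1 + (cyclotomicExponent p)))) b₀ =
          PadicInt.toZModPow (n + 1 + (cyclotomicExponent p)) ((w : ℤ_[p]ˣ) : ℤ_[p]) *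
            (cyclotomicGenerator p : ZMod (p ^ (n + 1 + (cyclotomicExponent p)))) ^ t := by
        rw [hb₀, map_mul, map_pow, map_natCast, ZMod.castHom_apply,
          PadicInt.cast_toZModPow _ _ (by omega)]
      rw [hcast, hpdiv] at horb
      rw [← horb]
      refine Finset.sum_congr rfl fun j _ ↦ ?_
      rw [hb₀, pow_add (cyclotomicGenerator p : ZMod (p ^ (n + 2 + (cyclotomicExponent p)))) t (p ^ (n + 1) * j),
        pow_mul (cyclotomicGenerator p : ZMod (p ^ (n + 2 + (cyclotomicExponent p)))) (p ^ (n + 1)) j, mul_assoc]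
    -- Step 2: `[p · x/p^{n+1+e₀}]⁺ = [(x mod p^{n+e₀})/p^{n+e₀}]⁺` and `t = t' + p^n k`
    have h2 : ∀ w : rootsOfUnity (torsionOrder p) ℤ_[p],
        ∑ t ∈ Finset.range (p ^ (n + 1)),
          π (C (ratPlusSymbol f
            (((PadicInt.toZModPow (n + 1 + (cyclotomicExponent p)) ((w : ℤ_[p]ˣ) : ℤ_[p]) *
                (cyclotomicGenerator p : ZMod (p ^ (n + 1 + (cyclotomicExponent p)))) ^ t).val : ℚ) /
              (p : ℚ) ^ (n + (cyclotomicExponent p))))) * u ^ t =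
        ∑ k ∈ Finset.range p, ∑ t ∈ Finset.range (p ^ n),
          π (C (A w t)) * (u ^ t * (u ^ p ^ n) ^ k) := by
      intro w
      rw [show p ^ (n + 1) = p * p ^ n by ring, sum_range_mul_eq_sum_sum]
      refine Finset.sum_congr rfl fun k _ ↦ ?_
      refine Finset.sum_congr rfl fun t _ ↦ ?_
      have hx : ∀ x : ZMod (p ^ (n + 1 + (cyclotomicExponent p))),
          ratPlusSymbol f ((x.val : ℚ) / (p : ℚ) ^ (n + (cyclotomicExponent p))) =
            ratPlusSymbol f (((ZMod.castHom hdvdIS (ZMod (p ^ (n + (cyclotomicExponent p)))) x).val : ℚ) /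
              (p : ℚ) ^ (n + (cyclotomicExponent p))) := by
        intro x
        rw [← ratPlusSymbol_mul_div_pow_eq hIS hdvdIS x, hpdiv]
      rw [hx, map_mul, map_pow, map_natCast, ZMod.castHom_apply,
        PadicInt.cast_toZModPow _ _ (by omega),
        pow_add (cyclotomicGenerator p : ZMod (p ^ (n + (cyclotomicExponent p)))) t (p ^ n * k),
        pow_mul (cyclotomicGenerator p : ZMod (p ^ (n + (cyclotomicExponent p)))) (p ^ n) k, hγS, one_pow, mul_one,
        pow_add u t (p ^ n * k), pow_mul u (p ^ n) k]
    simp_rw [h1, h2]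
    rw [hT, ← Finset.sum_neg_distrib]
  rw [map_add, map_mul, hLHS, hRHS, neg_add_cancel]

end ThreeTerm

/-! ## §4. The polynomials `ω_n^±`: recursions and monicity -/

section OmegaIdentities

variable (p : ℕ) [hp : Fact p.Prime]

/-- `ω_{n+1} = ω_n · Φ_{p^{n+1}}(1+T)` (Mathlib `cyclotomic_prime_pow_mul_X_pow_sub_one` at `1 + T`).
[cite: Pollack2003, §6.5 (display before Prop. 6.18)] -/
theorem cyclotomicOmega_succ (n : ℕ) :
    cyclotomicOmega p (n + 1) = cyclotomicOmega p n * (cyclotomic (p ^ (n + 1)) ℤ).comp (X + 1) := by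
  have h := congr_arg (fun q : ℤ[X] ↦ q.comp (X + 1)) (cyclotomic_prime_pow_mul_X_pow_sub_one ℤ p n)
  simp only [mul_comp, sub_comp, pow_comp, X_comp, one_comp] at h
  rw [cyclotomicOmega, cyclotomicOmega, ← h, mul_comm]

omit hp in
/-- `ω⁻_{2m+2} = ω⁻_{2m} · Φ_{p^{2m+1}}(1+T)`. [cite: Pollack2003, §6.5 (display before Prop. 6.18)] -/
theorem cyclotomicOmegaMinus_two_mul_add_two (m : ℕ) :
    cyclotomicOmegaMinus p (2 * m + 2) =
      cyclotomicOmegaMinus p (2 * m) * (cyclotomic (p ^ (2 * m + 1)) ℤ).comp (X + 1) := by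
  simp only [cyclotomicOmegaMinus]
  rw [show (2 * m + 2 + 1) / 2 = m + 1 by omega, show (2 * m + 1) / 2 = m by omega,
    Finset.prod_Icc_succ_top (Nat.le_add_left 1 m), show 2 * (m + 1) - 1 = 2 * m + 1 by omega]

omit hp in
/-- `ω⁻_{2m+1} = ω⁻_{2m+2}` (no new odd-index factor). [cite: Pollack2003, §6.5 (display before Prop. 6.18)] -/
theorem cyclotomicOmegaMinus_two_mul_add_one (m : ℕ) :
    cyclotomicOmegaMinus p (2 * m + 1) = cyclotomicOmegaMinus p (2 * m + 2) := by
  simp only [cyclotomicOmegaMinus]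
  rw [show (2 * m + 1 + 1) / 2 = m + 1 by omega, show (2 * m + 2 + 1) / 2 = m + 1 by omega]

omit hp in
/-- `ω⁺_{2m+1} = ω⁺_{2m}` (no new even-index factor). [cite: Pollack2003, §6.5 (display before Prop. 6.18)] -/
theorem cyclotomicOmegaPlus_two_mul_add_one (m : ℕ) :
    cyclotomicOmegaPlus p (2 * m + 1) = cyclotomicOmegaPlus p (2 * m) := by
  simp only [cyclotomicOmegaPlus]
  rw [show (2 * m + 1) / 2 = m by omega, show 2 * m / 2 = m by omega]

omit hp in
/-- `ω⁺_{2m+2} = ω⁺_{2m} · Φ_{p^{2m+2}}(1+T)`. [cite: Pollack2003, §6.5 (display before Prop. 6.18)] -/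
theorem cyclotomicOmegaPlus_two_mul_add_two (m : ℕ) :
    cyclotomicOmegaPlus p (2 * m + 2) =
      cyclotomicOmegaPlus p (2 * m) * (cyclotomic (p ^ (2 * m + 2)) ℤ).comp (X + 1) := by
  simp only [cyclotomicOmegaPlus]
  rw [show (2 * m + 2) / 2 = m + 1 by omega, show 2 * m / 2 = m by omega,
    Finset.prod_Icc_succ_top (Nat.le_add_left 1 m), show 2 * (m + 1) = 2 * m + 2 by omega]

omit hp in
/-- `Φ_k(1+T) ∈ ℤ[T]` is monic (so `ω_n, ω_n^±` are distinguished polynomials, Pollack 2003 §6.5).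
[cite: Pollack2003, §6.5 (display before Prop. 6.18)] -/
theorem monic_cyclotomic_comp_X_add_one (k : ℕ) : ((cyclotomic k ℤ).comp (X + 1)).Monic := by
  have h1 : ((X : ℤ[X]) + 1) = X + C 1 := by rw [C_1]
  rw [h1]
  exact (cyclotomic.monic k ℤ).comp (monic_X_add_C 1) (by rw [natDegree_X_add_C]; exact one_ne_zero)

omit hp in
/-- `ω_n^+` is monic. [cite: Pollack2003, §6.5 (display before Prop. 6.18)] -/
theorem monic_cyclotomicOmegaPlus (n : ℕ) : (cyclotomicOmegaPlus p n).Monic :=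
  monic_prod_of_monic _ _ fun _ _ ↦ monic_cyclotomic_comp_X_add_one _

omit hp in
/-- `ω_n^-` is monic. [cite: Pollack2003, §6.5 (display before Prop. 6.18)] -/
theorem monic_cyclotomicOmegaMinus (n : ℕ) : (cyclotomicOmegaMinus p n).Monic :=
  monic_prod_of_monic _ _ fun _ _ ↦ monic_cyclotomic_comp_X_add_one _

/-- `ω_n = (1+T)^{p^n} − 1` is monic (a distinguished polynomial, Pollack 2003, Thm. 6.17).
[cite: Pollack2003, Thm. 6.17] -/
theorem monic_cyclotomicOmega (n : ℕ) : (cyclotomicOmega p n).Monic := by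
  rw [← X_mul_cyclotomicOmegaPlus_mul_cyclotomicOmegaMinus]
  exact (monic_X.mul (monic_cyclotomicOmegaPlus p n)).mul (monic_cyclotomicOmegaMinus p n)

end OmegaIdentities

/-! ## §5. `ω_n^∓ ∣ θ_n` and the compatible quotients -/

section Quotients

variable {N : ℕ} [NeZero N] {f : CuspForm (Gamma0 N) 2} {p : ℕ} [Fact p.Prime]

/-- **`ω⁻_{2m} ∣ θ_{2m}` in `ℚ[T]`** (`a_p = 0`): by induction on `m` from the three-term relation
`θ_{2m+2} = ω_{2m+1} C − Φ_{p^{2m+1}}(1+T) θ_{2m}`, since `ω⁻_{2m+2} = ω⁻_{2m} Φ_{p^{2m+1}}(1+T)`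
divides both `ω_{2m+1} = T ω⁺_{2m+1} ω⁻_{2m+1}` (`ω⁻_{2m+1} = ω⁻_{2m+2}`) and `Φ_{p^{2m+1}}(1+T) θ_{2m}`.
Equivalently: `θ_{2m}` vanishes at `ζ - 1` for every `ζ` of order `p^k`, `k` odd, `k < 2m`
(Pollack 2003, proof of Prop. 6.18). [cite: Pollack2003, Prop. 6.18 (proof)] -/
theorem cyclotomicOmegaMinus_dvd_mazurTateElement (hf0 : IsNewform0 f) (hQ : coeffField f = ⊥)
    (hpN : ¬ p ∣ N) (hap : cuspCoeff f p = ((0 : ℤ) : ℂ)) (m : ℕ) :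
    (cyclotomicOmegaMinus p (2 * m)).map (Int.castRingHom ℚ) ∣ mazurTateElement f p (2 * m) := by
  induction m with
  | zero => simp
  | succ m ih =>
    obtain ⟨C, hC⟩ := cyclotomicOmega_dvd_mazurTateElement_add hf0 hQ hpN hap (2 * m)
    have h : mazurTateElement f p (2 * (m + 1)) =
        (cyclotomicOmega p (2 * m + 1)).map (Int.castRingHom ℚ) * C -
          ((cyclotomic (p ^ (2 * m + 1)) ℤ).comp (X + 1)).map (Int.castRingHom ℚ) *
            mazurTateElement f p (2 * m) := by
      rw [show 2 * (m + 1) = 2 * m + 2 by ring, ← hC, add_sub_cancel_right]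
    rw [h, show 2 * (m + 1) = 2 * m + 2 by ring, cyclotomicOmegaMinus_two_mul_add_two,
      Polynomial.map_mul]
    refine dvd_sub (Dvd.dvd.mul_right ?_ _) ?_
    · rw [← Polynomial.map_mul, ← cyclotomicOmegaMinus_two_mul_add_two,
        ← cyclotomicOmegaMinus_two_mul_add_one, ← X_mul_cyclotomicOmegaPlus_mul_cyclotomicOmegaMinus]
      exact Polynomial.map_dvd _ (dvd_mul_left _ _)
    · rw [mul_comm (((cyclotomic (p ^ (2 * m + 1)) ℤ).comp (X + 1)).map (Int.castRingHom ℚ))]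
      exact mul_dvd_mul ih dvd_rfl

/-- **`ω⁺_{2m+1} ∣ θ_{2m+1}` in `ℚ[T]`** (`a_p = 0`), by the same induction from the three-term
relation at the odd levels (`ω⁺_1 = 1`; `ω⁺_{2m+3} = ω⁺_{2m+1} Φ_{p^{2m+2}}(1+T)`)
(Pollack 2003, proof of Prop. 6.18). [cite: Pollack2003, Prop. 6.18 (proof)] -/
theorem cyclotomicOmegaPlus_dvd_mazurTateElement (hf0 : IsNewform0 f) (hQ : coeffField f = ⊥)
    (hpN : ¬ p ∣ N) (hap : cuspCoeff f p = ((0 : ℤ) : ℂ)) (m : ℕ) :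
    (cyclotomicOmegaPlus p (2 * m + 1)).map (Int.castRingHom ℚ) ∣
      mazurTateElement f p (2 * m + 1) := by
  induction m with
  | zero =>
    rw [show 2 * 0 + 1 = 2 * 0 + 1 from rfl, cyclotomicOmegaPlus_two_mul_add_one, mul_zero,
      cyclotomicOmegaPlus_zero, Polynomial.map_one]
    exact one_dvd _
  | succ m ih =>
    obtain ⟨C, hC⟩ := cyclotomicOmega_dvd_mazurTateElement_add hf0 hQ hpN hap (2 * m + 1)
    have h : mazurTateElement f p (2 * (m + 1) + 1) =
        (cyclotomicOmega p (2 * m + 1 + 1)).map (Int.castRingHom ℚ) * C -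
          ((cyclotomic (p ^ (2 * m + 1 + 1)) ℤ).comp (X + 1)).map (Int.castRingHom ℚ) *
            mazurTateElement f p (2 * m + 1) := by
      rw [show 2 * (m + 1) + 1 = 2 * m + 1 + 2 by ring, ← hC, add_sub_cancel_right]
    have hω : cyclotomicOmegaPlus p (2 * (m + 1) + 1) =
        cyclotomicOmegaPlus p (2 * m + 1) * (cyclotomic (p ^ (2 * m + 1 + 1)) ℤ).comp (X + 1) := by
      rw [show 2 * (m + 1) + 1 = 2 * (m + 1) + 1 from rfl, cyclotomicOmegaPlus_two_mul_add_one,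
        show 2 * (m + 1) = 2 * m + 2 by ring, cyclotomicOmegaPlus_two_mul_add_two,
        cyclotomicOmegaPlus_two_mul_add_one, show 2 * m + 1 + 1 = 2 * m + 2 by ring]
    rw [h, hω, Polynomial.map_mul]
    refine dvd_sub (Dvd.dvd.mul_right ?_ _) ?_
    · rw [← Polynomial.map_mul, ← hω, ← X_mul_cyclotomicOmegaPlus_mul_cyclotomicOmegaMinus,
        show 2 * m + 1 + 1 = 2 * (m + 1) by ring, cyclotomicOmegaPlus_two_mul_add_one]
      exact Polynomial.map_dvd _ (Dvd.dvd.mul_right (dvd_mul_left _ _) _)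
    · rw [mul_comm (((cyclotomic (p ^ (2 * m + 1 + 1)) ℤ).comp (X + 1)).map (Int.castRingHom ℚ))]
      exact mul_dvd_mul ih dvd_rfl

/-- Exact division: if the monic `D` divides `P` then `D · (P /ₘ D) = P`. [folklore] -/
private theorem mul_divByMonic_eq_of_dvd {R : Type*} [CommRing R] {D P : R[X]} (hD : D.Monic)
    (h : D ∣ P) : D * (P /ₘ D) = P := by
  have h1 := modByMonic_add_div P D
  rwa [(modByMonic_eq_zero_iff_dvd hD).mpr h, zero_add] at h1

/-- **Compatibility of the even quotients**: with `ℓ⁻_m = θ_{2m}/ω⁻_{2m}` (exact quotient in `ℚ[T]`),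
`T ω⁺_{2m} ∣ (-1)^{m+2} ℓ⁻_{m+1} − (-1)^{m+1} ℓ⁻_m`. Indeed the three-term relation
`θ_{2m+2} + Φ_{p^{2m+1}}(1+T) θ_{2m} = ω_{2m+1} C` reads
`ω⁻_{2m} Φ_{p^{2m+1}}(1+T) (ℓ⁻_{m+1} + ℓ⁻_m) = T ω⁺_{2m} · ω⁻_{2m} Φ_{p^{2m+1}}(1+T) · C`, and
`ω⁻_{2m} Φ_{p^{2m+1}}(1+T) ≠ 0` cancels (Pollack 2003, proof of Prop. 6.18: the `L⁻`-values at
the `ζ - 1` are compatible along the tower). [cite: Pollack2003, Prop. 6.18 (proof)] -/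
theorem X_mul_cyclotomicOmegaPlus_dvd_sub_minus (hf0 : IsNewform0 f) (hQ : coeffField f = ⊥)
    (hpN : ¬ p ∣ N) (hap : cuspCoeff f p = ((0 : ℤ) : ℂ)) (m : ℕ) :
    X * (cyclotomicOmegaPlus p (2 * m)).map (Int.castRingHom ℚ) ∣
      (-1) ^ (m + 2) * (mazurTateElement f p (2 * (m + 1)) /ₘ
          (cyclotomicOmegaMinus p (2 * (m + 1))).map (Int.castRingHom ℚ)) -
        (-1) ^ (m + 1) * (mazurTateElement f p (2 * m) /ₘ
          (cyclotomicOmegaMinus p (2 * m)).map (Int.castRingHom ℚ)) := by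
  obtain ⟨C, hC⟩ := cyclotomicOmega_dvd_mazurTateElement_add hf0 hQ hpN hap (2 * m)
  set ξ : ℚ[X] := ((cyclotomic (p ^ (2 * m + 1)) ℤ).comp (X + 1)).map (Int.castRingHom ℚ) with hξ
  set ωm : ℚ[X] := (cyclotomicOmegaMinus p (2 * m)).map (Int.castRingHom ℚ) with hωm
  set ωp : ℚ[X] := (cyclotomicOmegaPlus p (2 * m)).map (Int.castRingHom ℚ) with hωp
  set ℓ₀ := mazurTateElement f p (2 * m) /ₘ ωm with hℓ₀
  set ℓ₁ := mazurTateElement f p (2 * (m + 1)) /ₘ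
    (cyclotomicOmegaMinus p (2 * (m + 1))).map (Int.castRingHom ℚ) with hℓ₁
  have hmon0 : ωm.Monic := (monic_cyclotomicOmegaMinus p (2 * m)).map _
  have hmon1 : ((cyclotomicOmegaMinus p (2 * (m + 1))).map (Int.castRingHom ℚ)).Monic :=
    (monic_cyclotomicOmegaMinus p _).map _
  have hθ0 : mazurTateElement f p (2 * m) = ωm * ℓ₀ :=
    (mul_divByMonic_eq_of_dvd hmon0 (cyclotomicOmegaMinus_dvd_mazurTateElement hf0 hQ hpN hap m)).symm
  have hθ1 : mazurTateElement f p (2 * (m + 1)) = ωm * ξ * ℓ₁ := by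
    have h := (mul_divByMonic_eq_of_dvd hmon1
      (cyclotomicOmegaMinus_dvd_mazurTateElement hf0 hQ hpN hap (m + 1))).symm
    rw [h, ← hℓ₁, show 2 * (m + 1) = 2 * m + 2 by ring, cyclotomicOmegaMinus_two_mul_add_two,
      Polynomial.map_mul]
  -- `ω_{2m+1} = T ω⁺_{2m} ω⁻_{2m} Φ_{p^{2m+1}}(1+T)`
  have hΩ : (cyclotomicOmega p (2 * m + 1)).map (Int.castRingHom ℚ) = X * ωp * (ωm * ξ) := by
    rw [← X_mul_cyclotomicOmegaPlus_mul_cyclotomicOmegaMinus, cyclotomicOmegaPlus_two_mul_add_one,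
      cyclotomicOmegaMinus_two_mul_add_one, cyclotomicOmegaMinus_two_mul_add_two,
      Polynomial.map_mul, Polynomial.map_mul, Polynomial.map_mul, Polynomial.map_X]
  have hne : ωm * ξ ≠ 0 :=
    (hmon0.mul ((monic_cyclotomic_comp_X_add_one (p ^ (2 * m + 1))).map _)).ne_zero
  -- cancel `ω⁻_{2m} Φ` in the three-term relation
  have hkey : ℓ₁ + ℓ₀ = X * ωp * C := by
    rw [show 2 * m + 2 = 2 * (m + 1) by ring, hθ1, hθ0, hΩ] at hC
    have h2 : ωm * ξ * (ℓ₁ + ℓ₀) = ωm * ξ * (X * ωp * C) := by linear_combination hC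
    exact mul_left_cancel₀ hne h2
  refine ⟨(-1) ^ (m + 2) * C, ?_⟩
  have h3 : ((-1 : ℚ[X]) ^ (m + 1)) = -((-1) ^ (m + 2)) := by ring
  rw [h3]
  linear_combination ((-1 : ℚ[X]) ^ (m + 2)) * hkey

/-- **Compatibility of the odd quotients**: with `ℓ⁺_m = θ_{2m+1}/ω⁺_{2m+1}`,
`T ω⁻_{2m+1} ∣ (-1)^{m+2} ℓ⁺_{m+1} − (-1)^{m+1} ℓ⁺_m`, from the three-term relation at level
`2m+1` (`ω_{2m+2} = T ω⁻_{2m+1} · ω⁺_{2m+1} Φ_{p^{2m+2}}(1+T)`)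
(Pollack 2003, proof of Prop. 6.18). [cite: Pollack2003, Prop. 6.18 (proof)] -/
theorem X_mul_cyclotomicOmegaMinus_dvd_sub_plus (hf0 : IsNewform0 f) (hQ : coeffField f = ⊥)
    (hpN : ¬ p ∣ N) (hap : cuspCoeff f p = ((0 : ℤ) : ℂ)) (m : ℕ) :
    X * (cyclotomicOmegaMinus p (2 * m + 1)).map (Int.castRingHom ℚ) ∣
      (-1) ^ (m + 2) * (mazurTateElement f p (2 * (m + 1) + 1) /ₘ
          (cyclotomicOmegaPlus p (2 * (m + 1) + 1)).map (Int.castRingHom ℚ)) -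
        (-1) ^ (m + 1) * (mazurTateElement f p (2 * m + 1) /ₘ
          (cyclotomicOmegaPlus p (2 * m + 1)).map (Int.castRingHom ℚ)) := by
  obtain ⟨C, hC⟩ := cyclotomicOmega_dvd_mazurTateElement_add hf0 hQ hpN hap (2 * m + 1)
  set ξ : ℚ[X] := ((cyclotomic (p ^ (2 * m + 1 + 1)) ℤ).comp (X + 1)).map (Int.castRingHom ℚ)
    with hξ
  set ωp : ℚ[X] := (cyclotomicOmegaPlus p (2 * m + 1)).map (Int.castRingHom ℚ) with hωp
  set ωm : ℚ[X] := (cyclotomicOmegaMinus p (2 * m + 1)).map (Int.castRingHom ℚ) with hωm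
  set ℓ₀ := mazurTateElement f p (2 * m + 1) /ₘ ωp with hℓ₀
  set ℓ₁ := mazurTateElement f p (2 * (m + 1) + 1) /ₘ
    (cyclotomicOmegaPlus p (2 * (m + 1) + 1)).map (Int.castRingHom ℚ) with hℓ₁
  have hω1 : cyclotomicOmegaPlus p (2 * (m + 1) + 1) =
      cyclotomicOmegaPlus p (2 * m + 1) * (cyclotomic (p ^ (2 * m + 1 + 1)) ℤ).comp (X + 1) := by
    rw [show 2 * (m + 1) + 1 = 2 * (m + 1) + 1 from rfl, cyclotomicOmegaPlus_two_mul_add_one,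
      show 2 * (m + 1) = 2 * m + 2 by ring, cyclotomicOmegaPlus_two_mul_add_two,
      cyclotomicOmegaPlus_two_mul_add_one, show 2 * m + 1 + 1 = 2 * m + 2 by ring]
  have hmon0 : ωp.Monic := (monic_cyclotomicOmegaPlus p (2 * m + 1)).map _
  have hmon1 : ((cyclotomicOmegaPlus p (2 * (m + 1) + 1)).map (Int.castRingHom ℚ)).Monic :=
    (monic_cyclotomicOmegaPlus p _).map _
  have hθ0 : mazurTateElement f p (2 * m + 1) = ωp * ℓ₀ :=
    (mul_divByMonic_eq_of_dvd hmon0 (cyclotomicOmegaPlus_dvd_mazurTateElement hf0 hQ hpN hap m)).symm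
  have hθ1 : mazurTateElement f p (2 * (m + 1) + 1) = ωp * ξ * ℓ₁ := by
    have h := (mul_divByMonic_eq_of_dvd hmon1
      (cyclotomicOmegaPlus_dvd_mazurTateElement hf0 hQ hpN hap (m + 1))).symm
    rw [h, ← hℓ₁, hω1, Polynomial.map_mul]
  -- `ω_{2m+2} = T ω⁻_{2m+1} ω⁺_{2m+1} Φ_{p^{2m+2}}(1+T)`
  have hΩ : (cyclotomicOmega p (2 * m + 1 + 1)).map (Int.castRingHom ℚ) = X * ωm * (ωp * ξ) := by
    rw [← X_mul_cyclotomicOmegaPlus_mul_cyclotomicOmegaMinus,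
      show 2 * m + 1 + 1 = 2 * m + 2 by ring, cyclotomicOmegaPlus_two_mul_add_two,
      ← cyclotomicOmegaMinus_two_mul_add_one, ← cyclotomicOmegaPlus_two_mul_add_one,
      Polynomial.map_mul, Polynomial.map_mul, Polynomial.map_mul, Polynomial.map_X]
    ring
  have hne : ωp * ξ ≠ 0 :=
    (hmon0.mul ((monic_cyclotomic_comp_X_add_one (p ^ (2 * m + 1 + 1))).map _)).ne_zero
  have hkey : ℓ₁ + ℓ₀ = X * ωm * C := by
    rw [show 2 * m + 1 + 2 = 2 * (m + 1) + 1 by ring, hθ1, hθ0, hΩ] at hC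
    have h2 : ωp * ξ * (ℓ₁ + ℓ₀) = ωp * ξ * (X * ωm * C) := by linear_combination hC
    exact mul_left_cancel₀ hne h2
  refine ⟨(-1) ^ (m + 2) * C, ?_⟩
  have h3 : ((-1 : ℚ[X]) ^ (m + 1)) = -((-1) ^ (m + 2)) := by ring
  rw [h3]
  linear_combination ((-1 : ℚ[X]) ^ (m + 2)) * hkey

end Quotients

/-! ## §6. Completeness of `Λ = ℤ_p⟦T⟧` along a tower of Eisenstein-type polynomials -/

section Limits

open Filter _root_.Topology

variable {p : ℕ} [hp : Fact p.Prime]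

/-- If `p ∣ ξ(0)` and `p^{K-j} ∣ P_j` for all `j`, then `p^{K+1-j} ∣ (P ξ)_j` for all `j`
(truncated subtraction): multiplying by a polynomial with constant term in `(p)` raises the
`(p, T)`-adic order by one. [folklore] -/
private theorem pow_sub_dvd_coeff_mul {K : ℕ} {P ξ : ℤ_[p][X]} (hξ : (p : ℤ_[p]) ∣ ξ.coeff 0)
    (hP : ∀ j, (p : ℤ_[p]) ^ (K - j) ∣ P.coeff j) (j : ℕ) :
    (p : ℤ_[p]) ^ (K + 1 - j) ∣ (P * ξ).coeff j := by
  rw [coeff_mul]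
  refine Finset.dvd_sum fun x hx ↦ ?_
  obtain ⟨a, b⟩ := x
  have hab : a + b = j := Finset.HasAntidiagonal.mem_antidiagonal.mp hx
  dsimp only
  rcases Nat.eq_zero_or_pos b with rfl | hpos
  · rw [add_zero] at hab
    subst hab
    calc (p : ℤ_[p]) ^ (K + 1 - a) ∣ (p : ℤ_[p]) ^ (K - a) * p := by
          rcases le_or_gt a K with h | h
          · rw [show K + 1 - a = (K - a) + 1 by omega, pow_succ]
          · rw [show K + 1 - a = 0 by omega, pow_zero]
            exact one_dvd _
      _ ∣ P.coeff a * ξ.coeff 0 := mul_dvd_mul (hP a) hξ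
  · calc (p : ℤ_[p]) ^ (K + 1 - j) ∣ (p : ℤ_[p]) ^ (K - a) := pow_dvd_pow _ (by omega)
      _ ∣ P.coeff a * ξ.coeff b := Dvd.dvd.mul_right (hP a) _

/-- `p^{K-j}` divides the `j`-th coefficient of `P · ∏_{i<K} ξ_i` when every `ξ_i` has constant
term in `(p)` (e.g. `ξ_i = Φ_{p^{k_i}}(1+T)`, constant term `p`). [folklore] -/
private theorem pow_sub_dvd_coeff_mul_prod (ξ : ℕ → ℤ_[p][X])
    (hξ : ∀ i, (p : ℤ_[p]) ∣ (ξ i).coeff 0) (P : ℤ_[p][X]) (K j : ℕ) :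
    (p : ℤ_[p]) ^ (K - j) ∣ (P * ∏ i ∈ Finset.range K, ξ i).coeff j := by
  induction K generalizing j with
  | zero =>
    rw [Nat.zero_sub, pow_zero]
    exact one_dvd _
  | succ K ih =>
    rw [Finset.prod_range_succ, ← mul_assoc]
    exact pow_sub_dvd_coeff_mul (hξ K) ih j

/-- Norm form: `p^{K-j} ∣ c` in `ℤ_p` gives `|c| ≤ p^j · p^{-K}`. [folklore] -/
private theorem norm_le_of_pow_sub_dvd {K j : ℕ} {c : ℤ_[p]} (h : (p : ℤ_[p]) ^ (K - j) ∣ c) :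
    ‖c‖ ≤ (p : ℝ) ^ j * ((p : ℝ)⁻¹) ^ K := by
  obtain ⟨d, rfl⟩ := h
  have hp1 : 1 ≤ (p : ℝ) := by exact_mod_cast hp.out.one_lt.le
  have hp0 : (0 : ℝ) < p := by positivity
  calc ‖(p : ℤ_[p]) ^ (K - j) * d‖ = ((p : ℝ)⁻¹) ^ (K - j) * ‖d‖ := by
        rw [norm_mul, norm_pow, PadicInt.norm_p]
    _ ≤ ((p : ℝ)⁻¹) ^ (K - j) * 1 := by gcongr; exact PadicInt.norm_le_one d
    _ ≤ (p : ℝ) ^ j * ((p : ℝ)⁻¹) ^ K := by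
        rw [mul_one]
        rcases le_or_gt j K with hjK | hjK
        · have h1 : ((p : ℝ)⁻¹) ^ K = ((p : ℝ)⁻¹) ^ (K - j) * ((p : ℝ)⁻¹) ^ j := by
            rw [← pow_add, Nat.sub_add_cancel hjK]
          rw [h1, mul_comm ((p : ℝ) ^ j), mul_assoc, ← mul_pow, inv_mul_cancel₀ hp0.ne', one_pow,
            mul_one]
        · rw [show K - j = 0 by omega, pow_zero]
          have h1 : (p : ℝ) ^ j * ((p : ℝ)⁻¹) ^ K = (p : ℝ) ^ (j - K) := by
            rw [inv_pow, ← div_eq_mul_inv, div_eq_iff (by positivity), ← pow_add,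
              Nat.sub_add_cancel hjK.le]
          rw [h1]
          exact one_le_pow₀ hp1

/-- **Coefficientwise limits in `ℤ_p⟦T⟧`**: a sequence of polynomials over `ℤ_p` whose successive
differences have `j`-th coefficient of norm `≤ p^j p^{-M}` converges coefficientwise to a power
series (`ℤ_p` is complete). [folklore] -/
private theorem exists_powerSeries_tendsto_coeff (P : ℕ → ℤ_[p][X])
    (hP : ∀ M j, ‖(P (M + 1) - P M).coeff j‖ ≤ (p : ℝ) ^ j * ((p : ℝ)⁻¹) ^ M) :
    ∃ L : PowerSeries ℤ_[p], ∀ j,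
      Tendsto (fun M ↦ (P M).coeff j) atTop (𝓝 (PowerSeries.coeff j L)) := by
  have hcau : ∀ j, CauchySeq (fun M ↦ (P M).coeff j) := fun j ↦ by
    refine cauchySeq_of_le_geometric ((p : ℝ)⁻¹) ((p : ℝ) ^ j)
      (inv_lt_one_of_one_lt₀ (by exact_mod_cast hp.out.one_lt)) fun M ↦ ?_
    rw [dist_eq_norm, ← norm_neg, neg_sub, ← coeff_sub]
    exact hP M j
  choose l hl using fun j ↦ cauchySeq_tendsto_of_complete (hcau j)
  exact ⟨PowerSeries.mk l, fun j ↦ by rw [PowerSeries.coeff_mk]; exact hl j⟩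

/-- Coefficientwise limits commute with multiplication by a fixed polynomial. [folklore] -/
private theorem tendsto_coeff_mul (D : ℤ_[p][X]) {P : ℕ → ℤ_[p][X]} {L : PowerSeries ℤ_[p]}
    (h : ∀ j, Tendsto (fun M ↦ (P M).coeff j) atTop (𝓝 (PowerSeries.coeff j L))) (j : ℕ) :
    Tendsto (fun M ↦ (D * P M).coeff j) atTop
      (𝓝 (PowerSeries.coeff j ((D : PowerSeries ℤ_[p]) * L))) := by
  simp_rw [coeff_mul]
  rw [PowerSeries.coeff_mul]
  refine tendsto_finsetSum _ fun x _ ↦ ?_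
  rw [Polynomial.coeff_coe]
  exact (h x.2).const_mul _

/-- **Completeness of `Λ = ℤ_p⟦T⟧` along a tower.** Let `ξ_0, ξ_1, …` be polynomials over `ℤ_p`
with constant terms in `(p)`, `B` any polynomial, `D_m = B · ∏_{i<m} ξ_i`, and let `g_0, g_1, …` be polynomials with
`g_{M+1} − g_M ∈ D_M · ℤ_p[T]` (a compatible system in `lim Λ/(D_m)`). Then there is `L ∈ Λ` with
`L ≡ g_m (mod D_m Λ)` for every `m`: `L = lim g_M` coefficientwise (the differences lie in
`B · (p, T)^M`), and `(L − g_m)/D_m = lim_M (g_M − g_m)/D_m` coefficientwise as well. This is the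
mechanism of Lang, *Cyclotomic Fields I and II*, Ch. 5 §1, Thm. 1.1 ("The homomorphism
`ε : Λ = ℤ_p⟦X⟧ → lim ℤ_p[X]/(h_n)` is an isomorphism", via `h_n ∈ (p, X)^{n+1}`)
[corpus: book:lang1990-cyclotomic-fields-i-ii p. 94], run for the sub-tower `D_m` of products of
polynomials with constant term in `(p)` (the even/odd halves `T ω_n^±` of the cyclotomic tower).
[cite: Lang1990, Ch. 5 §1 Thm. 1.1] -/
theorem exists_powerSeries_sub_eq_mul (B : ℤ_[p][X]) (ξ : ℕ → ℤ_[p][X])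
    (hξ : ∀ i, (p : ℤ_[p]) ∣ (ξ i).coeff 0) (g s : ℕ → ℤ_[p][X])
    (hg : ∀ M, g (M + 1) - g M = B * (∏ i ∈ Finset.range M, ξ i) * s M) :
    ∃ L : PowerSeries ℤ_[p], ∀ m, ∃ Q : PowerSeries ℤ_[p],
      L - (g m : PowerSeries ℤ_[p]) =
        ((B * ∏ i ∈ Finset.range m, ξ i : ℤ_[p][X]) : PowerSeries ℤ_[p]) * Q := by
  -- Step 1: `g` converges coefficientwise
  have hbound : ∀ M j, ‖(g (M + 1) - g M).coeff j‖ ≤ (p : ℝ) ^ j * ((p : ℝ)⁻¹) ^ M := by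
    intro M j
    rw [hg M, show B * (∏ i ∈ Finset.range M, ξ i) * s M = B * s M * ∏ i ∈ Finset.range M, ξ i
      by ring]
    exact norm_le_of_pow_sub_dvd (pow_sub_dvd_coeff_mul_prod ξ hξ (B * s M) M j)
  obtain ⟨L, hL⟩ := exists_powerSeries_tendsto_coeff g hbound
  refine ⟨L, fun m ↦ ?_⟩
  -- Step 2: `g_{m+M} - g_m = D_m · R_M` with `R_M = ∑_{k<M} (∏_{i<k} ξ_{m+i}) s_{m+k}`
  set D : ℤ_[p][X] := B * ∏ i ∈ Finset.range m, ξ i with hD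
  set R : ℕ → ℤ_[p][X] := fun M ↦
    ∑ k ∈ Finset.range M, (∏ i ∈ Finset.range k, ξ (m + i)) * s (m + k) with hR
  have hstep : ∀ k, g (m + k + 1) - g (m + k) =
      D * ((∏ i ∈ Finset.range k, ξ (m + i)) * s (m + k)) := by
    intro k
    rw [hg (m + k), hD, ← Finset.prod_range_mul_prod_Ico _ (Nat.le_add_right m k),
      Finset.prod_Ico_eq_prod_range, Nat.add_sub_cancel_left]
    ring
  have htel : ∀ M, g (m + M) - g m = D * R M := by
    intro M
    induction M with
    | zero => simp [hR]
    | succ M ih =>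
      have hR1 : R (M + 1) = R M + (∏ i ∈ Finset.range M, ξ (m + i)) * s (m + M) := by
        simp only [hR, Finset.sum_range_succ]
      rw [hR1, mul_add, ← ih, ← hstep, ← add_assoc]
      ring
  -- Step 3: `R` converges coefficientwise
  have hRb : ∀ M j, ‖(R (M + 1) - R M).coeff j‖ ≤ (p : ℝ) ^ j * ((p : ℝ)⁻¹) ^ M := by
    intro M j
    have h1 : R (M + 1) - R M = s (m + M) * ∏ i ∈ Finset.range M, ξ (m + i) := by
      rw [hR]
      dsimp only
      rw [Finset.sum_range_succ, add_sub_cancel_left, mul_comm]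
    rw [h1]
    exact norm_le_of_pow_sub_dvd
      (pow_sub_dvd_coeff_mul_prod (fun i ↦ ξ (m + i)) (fun i ↦ hξ _) _ M j)
  obtain ⟨Q, hQ⟩ := exists_powerSeries_tendsto_coeff R hRb
  refine ⟨Q, PowerSeries.ext fun j ↦ ?_⟩
  -- both sides are the limit of `(g_{m+M} - g_m)_j = (D R_M)_j`
  have h1 : Tendsto (fun M ↦ (D * R M).coeff j) atTop
      (𝓝 (PowerSeries.coeff j ((D : PowerSeries ℤ_[p]) * Q))) := tendsto_coeff_mul D hQ j
  have h2 : Tendsto (fun M ↦ (D * R M).coeff j) atTop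
      (𝓝 (PowerSeries.coeff j (L - (g m : PowerSeries ℤ_[p])))) := by
    simp_rw [← htel, coeff_sub]
    rw [map_sub, Polynomial.coeff_coe]
    refine Tendsto.sub ?_ tendsto_const_nhds
    have h3 : (fun M ↦ (g (m + M)).coeff j) = fun M ↦ (fun n ↦ (g n).coeff j) (M + m) := by
      ext M
      rw [add_comm]
    rw [h3]
    exact (tendsto_add_atTop_iff_nat m).mpr (hL j)
  exact tendsto_nhds_unique h2 h1

end Limits

/-! ## §7. `p`-integrality of `θ_n` and descent of divisibilities to `ℤ_p[T]` -/

section Integral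

variable {N : ℕ} [NeZero N] {f : CuspForm (Gamma0 N) 2} {p : ℕ} [Fact p.Prime]

/-- **`p`-integrality of the symbols `[a/p^k]⁺_f` at a prime with `a_p = 0`** (`p` odd, `p ∤ N`):
the Eisenstein multiple `(a_p − p − 1){∞, 0} = −(p+1){∞,0}` lies in `Λ_f`
(`sub_mul_modularSymbol_zero_mem_periodLattice`) and `p ∤ p + 1`, so `[a/p^k]⁺ ∈ (4(p+1))⁻¹ℤ` is
`p`-integral (`norm_ratPlusSymbol_le_one`; Stevens 1989 §4, Greenberg–Vatsal 2000 Prop. 3.7 for the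
lattice `Λ_f`; Pollack 2003, Thm. 5.6: "`L_p^±(E,T) ∈ ℤ_p⟦T⟧`"). [cite: Pollack2003, Thm. 5.6] -/
theorem norm_ratPlusSymbol_div_pow_le_one (hp2 : p ≠ 2) (hf0 : IsNewform0 f) (hpN : ¬ p ∣ N)
    (hap : cuspCoeff f p = ((0 : ℤ) : ℂ)) (a k : ℕ) :
    ‖((ratPlusSymbol f ((a : ℚ) / (p : ℚ) ^ k) : ℚ) : ℚ_[p])‖ ≤ 1 := by
  have hp : p.Prime := Fact.out
  have h0 : (((-((p : ℤ) + 1) : ℤ) : ℂ)) * modularSymbol f 0 ∈ periodLattice f := by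
    have h := sub_mul_modularSymbol_zero_mem_periodLattice hf0 hp hpN
    rw [hap] at h
    convert h using 2
    push_cast
    ring
  have hpn : ¬ (p : ℤ) ∣ -((p : ℤ) + 1) := by
    rw [dvd_neg]
    intro h
    have h1 : (p : ℤ) ∣ 1 := by
      have h2 := dvd_sub h (dvd_refl (p : ℤ))
      rwa [add_sub_cancel_left] at h2
    exact hp.ne_one (by exact_mod_cast Int.eq_one_of_dvd_one (by positivity) h1)
  exact norm_ratPlusSymbol_le_one f hp2 hpn h0 (coprime_den_div_prime_pow hpN a k)

/-- **`θ_n ∈ ℤ_p[T]`**: the Mazur–Tate element has `p`-integral coefficients, i.e. its image in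
`ℚ_p[T]` lifts to `ℤ_p[T]` (Pollack 2003, Thm. 5.6 / §6: `θ_n ∈ Λ_n = ℤ_p[T]/(ω_n)`).
[cite: Pollack2003, Thm. 5.6] -/
theorem exists_map_eq_map_mazurTateElement (hp2 : p ≠ 2) (hf0 : IsNewform0 f) (hpN : ¬ p ∣ N)
    (hap : cuspCoeff f p = ((0 : ℤ) : ℂ)) (n : ℕ) :
    ∃ Θ : ℤ_[p][X], Θ.map (algebraMap ℤ_[p] ℚ_[p]) =
      (mazurTateElement f p n).map (algebraMap ℚ ℚ_[p]) := by
  classical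
  haveI := neZero_torsionOrder p
  haveI := Fintype.ofFinite (rootsOfUnity (torsionOrder p) ℤ_[p])
  rw [← Polynomial.mem_lifts, mazurTateElement, finsum_eq_sum_of_fintype, Polynomial.map_sum]
  refine Subsemiring.sum_mem _ fun w _ ↦ ?_
  rw [Polynomial.map_sum]
  refine Subsemiring.sum_mem _ fun s _ ↦ ?_
  rw [Polynomial.map_mul, Polynomial.map_pow, Polynomial.map_add, Polynomial.map_X,
    Polynomial.map_one, Polynomial.map_C]
  refine Subsemiring.mul_mem _ ?_ (Subsemiring.pow_mem _
    (Subsemiring.add_mem _ (X_mem_lifts _) (Subsemiring.one_mem _)) _)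
  set q : ℚ := ratPlusSymbol f
    (((PadicInt.toZModPow (n + cyclotomicExponent p) ((w : ℤ_[p]ˣ) : ℤ_[p]) *
        (cyclotomicGenerator p : ZMod (p ^ (n + cyclotomicExponent p))) ^ s.val).val : ℚ) /
      (p : ℚ) ^ (n + cyclotomicExponent p)) with hq
  have hnorm : ‖(q : ℚ_[p])‖ ≤ 1 := norm_ratPlusSymbol_div_pow_le_one hp2 hf0 hpN hap _ _
  have heq : algebraMap ℚ ℚ_[p] q = algebraMap ℤ_[p] ℚ_[p] ⟨(q : ℚ_[p]), hnorm⟩ := by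
    rw [eq_ratCast]
    rfl
  rw [heq]
  exact C_mem_lifts _ _

omit [NeZero N] in
/-- **Monic descent**: for `D, P ∈ ℤ_p[T]` with `D` monic, `D ∣ P` in `ℚ_p[T]` implies `D ∣ P` in
`ℤ_p[T]` (division with remainder by a monic polynomial commutes with base change). [folklore] -/
private theorem dvd_of_map_dvd_map {D P : ℤ_[p][X]} (hD : D.Monic)
    (h : D.map (algebraMap ℤ_[p] ℚ_[p]) ∣ P.map (algebraMap ℤ_[p] ℚ_[p])) : D ∣ P := by
  rw [← modByMonic_eq_zero_iff_dvd hD]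
  apply Polynomial.map_injective (algebraMap ℤ_[p] ℚ_[p]) (IsFractionRing.injective ℤ_[p] ℚ_[p])
  rw [Polynomial.map_modByMonic _ hD, Polynomial.map_zero]
  exact (modByMonic_eq_zero_iff_dvd (hD.map _)).mpr h

omit [NeZero N] in
/-- The two routes `ℤ[T] → ℚ[T] → ℚ_p[T]` and `ℤ[T] → ℤ_p[T] → ℚ_p[T]` agree. [folklore] -/
private theorem map_map_int_eq (q : ℤ[X]) :
    (q.map (Int.castRingHom ℚ)).map (algebraMap ℚ ℚ_[p]) =
      (q.map (Int.castRingHom ℤ_[p])).map (algebraMap ℤ_[p] ℚ_[p]) := by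
  rw [Polynomial.map_map, Polynomial.map_map,
    RingHom.ext_int ((algebraMap ℚ ℚ_[p]).comp (Int.castRingHom ℚ))
      ((algebraMap ℤ_[p] ℚ_[p]).comp (Int.castRingHom ℤ_[p]))]

omit [NeZero N] in
/-- Descent of a divisibility `D ∣ P` from `ℚ[T]` (with `D ∈ ℤ[T]` monic and `P` the image of a
`Θ ∈ ℤ_p[T]`) to `D ∣ Θ` in `ℤ_p[T]`. [folklore] -/
private theorem map_dvd_of_dvd {D : ℤ[X]} (hD : D.Monic) {P : ℚ[X]} {Θ : ℤ_[p][X]}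
    (hΘ : Θ.map (algebraMap ℤ_[p] ℚ_[p]) = P.map (algebraMap ℚ ℚ_[p]))
    (h : D.map (Int.castRingHom ℚ) ∣ P) : D.map (Int.castRingHom ℤ_[p]) ∣ Θ := by
  refine dvd_of_map_dvd_map (hD.map _) ?_
  rw [← map_map_int_eq, hΘ]
  exact Polynomial.map_dvd _ h

omit [NeZero N] [Fact p.Prime] in
/-- `ω⁺_{2m} = ∏_{i<m} Φ_{p^{2i+2}}(1+T)`. [cite: Pollack2003, §6.5 (display before Prop. 6.18)] -/
theorem cyclotomicOmegaPlus_two_mul_eq_prod (m : ℕ) :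
    cyclotomicOmegaPlus p (2 * m) =
      ∏ i ∈ Finset.range m, (cyclotomic (p ^ (2 * i + 2)) ℤ).comp (X + 1) := by
  induction m with
  | zero => rw [mul_zero, cyclotomicOmegaPlus_zero, Finset.prod_range_zero]
  | succ m ih =>
    rw [show 2 * (m + 1) = 2 * m + 2 by ring, cyclotomicOmegaPlus_two_mul_add_two, ih,
      Finset.prod_range_succ]

omit [NeZero N] [Fact p.Prime] in
/-- `ω⁻_{2m+1} = Φ_p(1+T) · ∏_{i<m} Φ_{p^{2i+3}}(1+T)`. [cite: Pollack2003, §6.5 (display before Prop. 6.18)] -/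
theorem cyclotomicOmegaMinus_two_mul_add_one_eq_prod (m : ℕ) :
    cyclotomicOmegaMinus p (2 * m + 1) = (cyclotomic p ℤ).comp (X + 1) *
      ∏ i ∈ Finset.range m, (cyclotomic (p ^ (2 * i + 3)) ℤ).comp (X + 1) := by
  induction m with
  | zero =>
    rw [mul_zero, Finset.prod_range_zero, mul_one, cyclotomicOmegaMinus]
    rw [show (0 + 1 + 1) / 2 = 1 from rfl, Finset.Icc_self, Finset.prod_singleton,
      show 2 * 1 - 1 = 1 from rfl, pow_one]
  | succ m ih =>
    rw [show 2 * (m + 1) + 1 = 2 * (m + 1) + 1 from rfl, cyclotomicOmegaMinus_two_mul_add_one,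
      show 2 * (m + 1) + 2 = 2 * (m + 1) + 2 from rfl, cyclotomicOmegaMinus_two_mul_add_two,
      show 2 * (m + 1) = 2 * m + 2 by ring, ← cyclotomicOmegaMinus_two_mul_add_one, ih,
      Finset.prod_range_succ, show 2 * m + 2 + 1 = 2 * m + 3 by ring, mul_assoc]

omit [NeZero N] in
/-- The constant term of `Φ_{p^{k+1}}(1+T)` is `Φ_{p^{k+1}}(1) = p`. [folklore] -/
private theorem dvd_coeff_zero_cyclotomic_comp (k : ℕ) :
    (p : ℤ_[p]) ∣ (((cyclotomic (p ^ (k + 1)) ℤ).comp (X + 1)).map (Int.castRingHom ℤ_[p])).coeff 0 := by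
  rw [coeff_map, coeff_zero_eq_eval_zero, eval_comp, eval_add, eval_X, eval_one, zero_add,
    eval_one_cyclotomic_prime_pow, map_natCast]

end Integral

/-! ## §8. The signed `p`-adic `L`-functions `L⁻`, `L⁺` and their congruences -/

section Construction

variable {N : ℕ} [NeZero N] {f : CuspForm (Gamma0 N) 2} {p : ℕ} [Fact p.Prime]

/-- The algebraic identity behind the congruence: if `Θ = Ω⁻ q`, `g = σ q` with `σ² = 1`,
`L − g = B Ω⁺' Q` and `Ω = B Ω⁺' Ω⁻`, then `Θ − σ Ω⁻ L = Ω (−σ Q)`. [folklore] -/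
private theorem sub_mul_eq_of_identities {R : Type*} [CommRing R] {Θ Ωm Ωp B q g L Q Ω σ : R}
    (hσ : σ * σ = 1) (hΘ : Θ = Ωm * q) (hg : g = σ * q) (hL : L - g = B * Ωp * Q)
    (hΩ : Ω = B * Ωp * Ωm) : Θ - σ * Ωm * L = Ω * -(σ * Q) := by
  have hL' : L = g + B * Ωp * Q := by rw [← hL]; ring
  rw [hL', hg, hΘ, hΩ]
  linear_combination (-(Ωm * q)) * hσ

/-- **Existence of `L⁻`**: for `p` odd, `f` rational with `p ∤ N` and `a_p = 0`, there is
`L⁻ ∈ Λ = ℤ_p⟦T⟧` with `θ_{2m} ≡ (-1)^{m+1} ω⁻_{2m} L⁻ (mod ω_{2m} Λ)` for every `m` — even, as an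
identity `θ_{2m} − (-1)^{m+1} ω⁻_{2m} L⁻ ∈ ω_{2m} Λ` WITHOUT inverting `p`. Construction:
`L⁻ = lim_m (-1)^{m+1} θ_{2m}/ω⁻_{2m}` in `Λ = lim Λ/(T ω⁺_{2m})` (`exists_powerSeries_sub_eq_mul`,
compatibility `X_mul_cyclotomicOmegaPlus_dvd_sub_minus`, integrality
`exists_map_eq_map_mazurTateElement`), and `T ω⁺_{2m} ω⁻_{2m} = ω_{2m}`
(Pollack 2003, Prop. 6.18 for even `n`; Kobayashi 2003 Thm. 3.2). [cite: Pollack2003, Prop. 6.18] -/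
theorem exists_isCongrModOmega_even (hp2 : p ≠ 2) (hf0 : IsNewform0 f) (hQ : coeffField f = ⊥)
    (hpN : ¬ p ∣ N) (hap : cuspCoeff f p = ((0 : ℤ) : ℂ)) :
    ∃ L : IwasawaAlgebra p, ∀ m : ℕ, IsCongrModOmega p (2 * m) (mazurTateElement f p (2 * m))
      ((-1) ^ (m + 1) * cyclotomicOmegaMinus p (2 * m)) L := by
  classical
  choose Θ hΘ using fun n ↦ exists_map_eq_map_mazurTateElement hp2 hf0 hpN hap n
  -- the polynomials over `ℤ_p`
  set Ωm : ℕ → ℤ_[p][X] := fun k ↦ (cyclotomicOmegaMinus p k).map (Int.castRingHom ℤ_[p])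
    with hΩm
  set Ωp : ℕ → ℤ_[p][X] := fun k ↦ (cyclotomicOmegaPlus p k).map (Int.castRingHom ℤ_[p])
    with hΩp
  have hmon : ∀ k, (Ωm k).Monic := fun k ↦ (monic_cyclotomicOmegaMinus p k).map _
  -- `Ω⁻_{2m} ∣ Θ_{2m}` in `ℤ_p[T]`
  have hdiv : ∀ m, Ωm (2 * m) ∣ Θ (2 * m) := fun m ↦
    map_dvd_of_dvd (monic_cyclotomicOmegaMinus p _) (hΘ _)
      (cyclotomicOmegaMinus_dvd_mazurTateElement hf0 hQ hpN hap m)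
  -- the signed quotients `g_m = (-1)^{m+1} Θ_{2m}/Ω⁻_{2m}`
  set g : ℕ → ℤ_[p][X] := fun m ↦ (-1) ^ (m + 1) * (Θ (2 * m) /ₘ Ωm (2 * m)) with hg
  have hgmap : ∀ m, (g m).map (algebraMap ℤ_[p] ℚ_[p]) =
      ((-1) ^ (m + 1) * (mazurTateElement f p (2 * m) /ₘ
        (cyclotomicOmegaMinus p (2 * m)).map (Int.castRingHom ℚ))).map (algebraMap ℚ ℚ_[p]) := by
    intro m
    rw [hg]
    dsimp only
    rw [Polynomial.map_mul, Polynomial.map_mul, Polynomial.map_pow, Polynomial.map_pow,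
      Polynomial.map_neg, Polynomial.map_neg, Polynomial.map_one, Polynomial.map_one,
      Polynomial.map_divByMonic _ (hmon _), Polynomial.map_divByMonic _
        ((monic_cyclotomicOmegaMinus p _).map _), hΘ, map_map_int_eq]
  -- compatibility `T ω⁺_{2m} ∣ g_{m+1} − g_m` in `ℤ_p[T]`
  have hcompat : ∀ m, X * Ωp (2 * m) ∣ g (m + 1) - g m := by
    intro m
    have hD : (X * cyclotomicOmegaPlus p (2 * m)).Monic := monic_X.mul (monic_cyclotomicOmegaPlus p _)
    have h1 : (X * cyclotomicOmegaPlus p (2 * m)).map (Int.castRingHom ℤ_[p]) = X * Ωp (2 * m) := by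
      rw [Polynomial.map_mul, Polynomial.map_X]
    rw [← h1]
    refine dvd_of_map_dvd_map (hD.map _) ?_
    rw [← map_map_int_eq, Polynomial.map_sub, hgmap, hgmap, ← Polynomial.map_sub,
      Polynomial.map_mul, Polynomial.map_X]
    exact Polynomial.map_dvd _ (X_mul_cyclotomicOmegaPlus_dvd_sub_minus hf0 hQ hpN hap m)
  choose s hs using hcompat
  -- the tower `T ω⁺_{2m} = T ∏_{i<m} Φ_{p^{2i+2}}(1+T)`
  set ξ : ℕ → ℤ_[p][X] := fun i ↦
    ((cyclotomic (p ^ (2 * i + 2)) ℤ).comp (X + 1)).map (Int.castRingHom ℤ_[p]) with hξ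
  have hξ0 : ∀ i, (p : ℤ_[p]) ∣ (ξ i).coeff 0 := fun i ↦ by
    rw [hξ]
    dsimp only
    rw [show 2 * i + 2 = (2 * i + 1) + 1 by ring]
    exact dvd_coeff_zero_cyclotomic_comp _
  have hΩpξ : ∀ m, Ωp (2 * m) = ∏ i ∈ Finset.range m, ξ i := fun m ↦ by
    rw [hΩp, hξ]
    dsimp only
    rw [cyclotomicOmegaPlus_two_mul_eq_prod, Polynomial.map_prod]
  obtain ⟨L, hL⟩ := exists_powerSeries_sub_eq_mul X ξ hξ0 g s fun M ↦ by rw [← hΩpξ, hs]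
  refine ⟨L, fun m ↦ ?_⟩
  obtain ⟨Q, hLQ⟩ := hL m
  rw [← hΩpξ] at hLQ
  refine ⟨0, -((-1) ^ (m + 1) * Q), ?_⟩
  -- everything is the image of an identity in `Λ = ℤ_p⟦T⟧`
  have hθ : (((mazurTateElement f p (2 * m)).map (algebraMap ℚ ℚ_[p]) : ℚ_[p][X]) :
      PowerSeries ℚ_[p]) = iwasawaToPowerSeries p (Θ (2 * m) : PowerSeries ℤ_[p]) := by
    rw [← hΘ, Polynomial.polynomial_map_coe]
  have hω : (((-1) ^ (m + 1) * cyclotomicOmegaMinus p (2 * m)).map (Int.castRingHom ℤ_[p]) :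
      PowerSeries ℤ_[p]) = (-1) ^ (m + 1) * (Ωm (2 * m) : PowerSeries ℤ_[p]) := by
    rw [Polynomial.map_mul, Polynomial.map_pow, Polynomial.map_neg, Polynomial.map_one,
      Polynomial.coe_mul, Polynomial.coe_pow, Polynomial.coe_neg, Polynomial.coe_one]
  have hΩ : (((cyclotomicOmega p (2 * m)).map (Int.castRingHom ℤ_[p]) : ℤ_[p][X]) :
      PowerSeries ℤ_[p]) = ((X : ℤ_[p][X]) : PowerSeries ℤ_[p]) * (Ωp (2 * m) : PowerSeries ℤ_[p]) *
        (Ωm (2 * m) : PowerSeries ℤ_[p]) := by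
    rw [← X_mul_cyclotomicOmegaPlus_mul_cyclotomicOmegaMinus, Polynomial.map_mul,
      Polynomial.map_mul, Polynomial.map_X, Polynomial.coe_mul, Polynomial.coe_mul]
  have hΘq : (Θ (2 * m) : PowerSeries ℤ_[p]) =
      (Ωm (2 * m) : PowerSeries ℤ_[p]) * ((Θ (2 * m) /ₘ Ωm (2 * m) : ℤ_[p][X]) : PowerSeries ℤ_[p]) := by
    rw [← Polynomial.coe_mul, mul_divByMonic_eq_of_dvd (hmon _) (hdiv m)]
  have hgq : (g m : PowerSeries ℤ_[p]) =
      (-1) ^ (m + 1) * ((Θ (2 * m) /ₘ Ωm (2 * m) : ℤ_[p][X]) : PowerSeries ℤ_[p]) := by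
    rw [hg]
    dsimp only
    rw [Polynomial.coe_mul, Polynomial.coe_pow, Polynomial.coe_neg, Polynomial.coe_one]
  have hσ : ((-1 : PowerSeries ℤ_[p]) ^ (m + 1)) * (-1) ^ (m + 1) = 1 := by
    rw [← mul_pow, neg_one_mul, neg_neg, one_pow]
  have hLQ' : L - (g m : PowerSeries ℤ_[p]) =
      ((X : ℤ_[p][X]) : PowerSeries ℤ_[p]) * (Ωp (2 * m) : PowerSeries ℤ_[p]) * Q := by
    rw [← Polynomial.coe_mul]
    exact hLQ
  have key := sub_mul_eq_of_identities hσ hΘq hgq hLQ' hΩ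
  rw [pow_zero, map_one, one_mul, hθ, hω, ← map_sub, key]

/-- **Existence of `L⁺`**: likewise there is `L⁺ ∈ Λ` with
`θ_{2m+1} ≡ (-1)^{m+1} ω⁺_{2m+1} L⁺ (mod ω_{2m+1} Λ)` for every `m`, as the limit of
`(-1)^{m+1} θ_{2m+1}/ω⁺_{2m+1}` in `Λ = lim Λ/(T ω⁻_{2m+1})`
(Pollack 2003, Prop. 6.18 for odd `n`; Kobayashi 2003 Thm. 3.2). [cite: Pollack2003, Prop. 6.18] -/
theorem exists_isCongrModOmega_odd (hp2 : p ≠ 2) (hf0 : IsNewform0 f) (hQ : coeffField f = ⊥)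
    (hpN : ¬ p ∣ N) (hap : cuspCoeff f p = ((0 : ℤ) : ℂ)) :
    ∃ L : IwasawaAlgebra p, ∀ m : ℕ,
      IsCongrModOmega p (2 * m + 1) (mazurTateElement f p (2 * m + 1))
        ((-1) ^ (m + 1) * cyclotomicOmegaPlus p (2 * m + 1)) L := by
  classical
  choose Θ hΘ using fun n ↦ exists_map_eq_map_mazurTateElement hp2 hf0 hpN hap n
  set Ωm : ℕ → ℤ_[p][X] := fun k ↦ (cyclotomicOmegaMinus p k).map (Int.castRingHom ℤ_[p])
    with hΩm
  set Ωp : ℕ → ℤ_[p][X] := fun k ↦ (cyclotomicOmegaPlus p k).map (Int.castRingHom ℤ_[p])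
    with hΩp
  have hmon : ∀ k, (Ωp k).Monic := fun k ↦ (monic_cyclotomicOmegaPlus p k).map _
  have hdiv : ∀ m, Ωp (2 * m + 1) ∣ Θ (2 * m + 1) := fun m ↦
    map_dvd_of_dvd (monic_cyclotomicOmegaPlus p _) (hΘ _)
      (cyclotomicOmegaPlus_dvd_mazurTateElement hf0 hQ hpN hap m)
  set g : ℕ → ℤ_[p][X] := fun m ↦ (-1) ^ (m + 1) * (Θ (2 * m + 1) /ₘ Ωp (2 * m + 1)) with hg
  have hgmap : ∀ m, (g m).map (algebraMap ℤ_[p] ℚ_[p]) =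
      ((-1) ^ (m + 1) * (mazurTateElement f p (2 * m + 1) /ₘ
        (cyclotomicOmegaPlus p (2 * m + 1)).map (Int.castRingHom ℚ))).map (algebraMap ℚ ℚ_[p]) := by
    intro m
    rw [hg]
    dsimp only
    rw [Polynomial.map_mul, Polynomial.map_mul, Polynomial.map_pow, Polynomial.map_pow,
      Polynomial.map_neg, Polynomial.map_neg, Polynomial.map_one, Polynomial.map_one,
      Polynomial.map_divByMonic _ (hmon _), Polynomial.map_divByMonic _
        ((monic_cyclotomicOmegaPlus p _).map _), hΘ, map_map_int_eq]
  have hcompat : ∀ m, X * Ωm (2 * m + 1) ∣ g (m + 1) - g m := by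
    intro m
    have hD : (X * cyclotomicOmegaMinus p (2 * m + 1)).Monic :=
      monic_X.mul (monic_cyclotomicOmegaMinus p _)
    have h1 : (X * cyclotomicOmegaMinus p (2 * m + 1)).map (Int.castRingHom ℤ_[p]) =
        X * Ωm (2 * m + 1) := by
      rw [Polynomial.map_mul, Polynomial.map_X]
    rw [← h1]
    refine dvd_of_map_dvd_map (hD.map _) ?_
    rw [← map_map_int_eq, Polynomial.map_sub, hgmap, hgmap, ← Polynomial.map_sub,
      Polynomial.map_mul, Polynomial.map_X]
    exact Polynomial.map_dvd _ (X_mul_cyclotomicOmegaMinus_dvd_sub_plus hf0 hQ hpN hap m)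
  choose s hs using hcompat
  -- the tower `T ω⁻_{2m+1} = (T Φ_p(1+T)) ∏_{i<m} Φ_{p^{2i+3}}(1+T)`
  set B : ℤ_[p][X] := X * ((cyclotomic p ℤ).comp (X + 1)).map (Int.castRingHom ℤ_[p]) with hB
  set ξ : ℕ → ℤ_[p][X] := fun i ↦
    ((cyclotomic (p ^ (2 * i + 3)) ℤ).comp (X + 1)).map (Int.castRingHom ℤ_[p]) with hξ
  have hξ0 : ∀ i, (p : ℤ_[p]) ∣ (ξ i).coeff 0 := fun i ↦ by
    rw [hξ]
    dsimp only
    rw [show 2 * i + 3 = (2 * i + 2) + 1 by ring]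
    exact dvd_coeff_zero_cyclotomic_comp _
  have hΩmξ : ∀ m, X * Ωm (2 * m + 1) = B * ∏ i ∈ Finset.range m, ξ i := fun m ↦ by
    rw [hΩm, hξ, hB]
    dsimp only
    rw [cyclotomicOmegaMinus_two_mul_add_one_eq_prod, Polynomial.map_mul, Polynomial.map_prod,
      mul_assoc]
  obtain ⟨L, hL⟩ := exists_powerSeries_sub_eq_mul B ξ hξ0 g s fun M ↦ by rw [← hΩmξ, hs]
  refine ⟨L, fun m ↦ ?_⟩
  obtain ⟨Q, hLQ⟩ := hL m
  rw [← hΩmξ] at hLQ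
  refine ⟨0, -((-1) ^ (m + 1) * Q), ?_⟩
  have hθ : (((mazurTateElement f p (2 * m + 1)).map (algebraMap ℚ ℚ_[p]) : ℚ_[p][X]) :
      PowerSeries ℚ_[p]) = iwasawaToPowerSeries p (Θ (2 * m + 1) : PowerSeries ℤ_[p]) := by
    rw [← hΘ, Polynomial.polynomial_map_coe]
  have hω : (((-1) ^ (m + 1) * cyclotomicOmegaPlus p (2 * m + 1)).map (Int.castRingHom ℤ_[p]) :
      PowerSeries ℤ_[p]) = (-1) ^ (m + 1) * (Ωp (2 * m + 1) : PowerSeries ℤ_[p]) := by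
    rw [Polynomial.map_mul, Polynomial.map_pow, Polynomial.map_neg, Polynomial.map_one,
      Polynomial.coe_mul, Polynomial.coe_pow, Polynomial.coe_neg, Polynomial.coe_one]
  have hΩ : (((cyclotomicOmega p (2 * m + 1)).map (Int.castRingHom ℤ_[p]) : ℤ_[p][X]) :
      PowerSeries ℤ_[p]) = ((X : ℤ_[p][X]) : PowerSeries ℤ_[p]) *
        (Ωm (2 * m + 1) : PowerSeries ℤ_[p]) * (Ωp (2 * m + 1) : PowerSeries ℤ_[p]) := by
    rw [← X_mul_cyclotomicOmegaPlus_mul_cyclotomicOmegaMinus, Polynomial.map_mul,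
      Polynomial.map_mul, Polynomial.map_X, Polynomial.coe_mul, Polynomial.coe_mul]
    ring
  have hΘq : (Θ (2 * m + 1) : PowerSeries ℤ_[p]) = (Ωp (2 * m + 1) : PowerSeries ℤ_[p]) *
      ((Θ (2 * m + 1) /ₘ Ωp (2 * m + 1) : ℤ_[p][X]) : PowerSeries ℤ_[p]) := by
    rw [← Polynomial.coe_mul, mul_divByMonic_eq_of_dvd (hmon _) (hdiv m)]
  have hgq : (g m : PowerSeries ℤ_[p]) =
      (-1) ^ (m + 1) * ((Θ (2 * m + 1) /ₘ Ωp (2 * m + 1) : ℤ_[p][X]) : PowerSeries ℤ_[p]) := by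
    rw [hg]
    dsimp only
    rw [Polynomial.coe_mul, Polynomial.coe_pow, Polynomial.coe_neg, Polynomial.coe_one]
  have hσ : ((-1 : PowerSeries ℤ_[p]) ^ (m + 1)) * (-1) ^ (m + 1) = 1 := by
    rw [← mul_pow, neg_one_mul, neg_neg, one_pow]
  have hLQ' : L - (g m : PowerSeries ℤ_[p]) =
      ((X : ℤ_[p][X]) : PowerSeries ℤ_[p]) * (Ωm (2 * m + 1) : PowerSeries ℤ_[p]) * Q := by
    rw [← Polynomial.coe_mul]
    exact hLQ
  have key := sub_mul_eq_of_identities hσ hΘq hgq hLQ' hΩ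
  rw [pow_zero, map_one, one_mul, hθ, hω, ← map_sub, key]

end Construction

/-! ## §9. Non-vanishing (Rohrlich) and the named fact -/

section NonVanishing

variable {W : WeierstrassCurve ℚ} [W.IsElliptic] [W.IsGloballyMinimal] {N : ℕ} [NeZero N]
  {f : CuspForm (Gamma0 N) 2} {p : ℕ} [Fact p.Prime]

omit [NeZero N] in
/-- If `θ_n ≡ ω · 0 (mod ω_n)`, every Birch sum `∑_a χ(a)[a/p^{n+e₀}]⁺_f` at an even character
`χ` of `p`-power order modulo `p^{n+e₀}` vanishes: evaluate the congruence at `χ(γ) − 1`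
(`IsCongrModOmega.eval₂_eq`, `eval₂_mazurTateElement_eq_ratTwistedSymbolSum`).
[cite: Pollack2003, Prop. 6.9 (proof)] -/
private theorem ratTwistedSymbolSum_eq_zero_of_isCongrModOmega_zero {n : ℕ} {ω : ℤ[X]}
    (h : IsCongrModOmega p n (mazurTateElement f p n) ω 0)
    (χ : DirichletCharacter ℂ_[p] (p ^ (n + cyclotomicExponent p))) (hev : χ.Even)
    (hord : ∃ j : ℕ, orderOf χ = p ^ j) : ratTwistedSymbolSum f χ = 0 := by
  set ζ : ℂ_[p] := χ (cyclotomicGenerator p : ZMod (p ^ (n + cyclotomicExponent p))) with hζ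
  have hpow : ζ ^ p ^ n = 1 := by
    rw [hζ, ← map_pow, ← orderOf_cyclotomicGenerator p n, pow_orderOf_eq_one, map_one]
  have hz : ‖ζ - 1‖ < 1 := norm_sub_one_lt_one_of_pow_prime_pow_eq_one hpow
  have hzn : (1 + (ζ - 1)) ^ p ^ n = 1 := by rwa [add_sub_cancel]
  have h1 := h.eval₂_eq hz hzn
  rw [eval₂_mazurTateElement_eq_ratTwistedSymbolSum f χ hev hord] at h1
  rw [h1]
  simp

/-- **Rohrlich's theorem forbids the vanishing of all Birch sums along a parity class of levels**:
if for some `a` every primitive even `p`-power-order character `χ` of conductor `p^{2i+a+3}`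
(`i ≥ 0`) has `∑_b χ(b)[b/p^{2i+a+3}]⁺_f = 0`, we reach a contradiction: by Birch's formula
(`ratTwistedSymbolSum_mul_plusPeriod`) `L(E, χ̄, 1) = 0` for infinitely many primitive `χ` of
`p`-power conductor, against `Rohrlich1984_nonvanishing_twists_holds` (Rohrlich 1984, Theorem
p. 409; the argument of `padicLFunction_ne_zero_of_rohrlich`). [cite: RohrlichInventiones1984, Theorem (p. 409)] -/
private theorem false_of_forall_ratTwistedSymbolSum_eq_zero (hf : IsNewformOf W f)
    (hgood : W.HasGoodReductionAtPrime p) (a : ℕ)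
    (hvan : ∀ (i : ℕ) (χ : DirichletCharacter ℂ_[p] (p ^ (2 * i + a + 3))), χ.IsPrimitive →
      χ.Even → (∃ j : ℕ, orderOf χ = p ^ j) → ratTwistedSymbolSum f χ = 0) : False := by
  classical
  have hp : p.Prime := Fact.out
  have hQ : coeffField f = ⊥ := hf.coeffField_eq_bot
  have hpN : ¬ p ∣ N := not_dvd_level_of_isNewformOf hf hgood
  have hR := Rohrlich1984_nonvanishing_twists_holds.primePow hf.1 hpN
  have hB : ratTwistedSymbolSum_mul_plusPeriod (f := f) :=
    ratTwistedSymbolSum_mul_plusPeriod_of_lattice isZLattice_periodLattice_holds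
      (exists_nsmul_modularSymbol_mem_periodLattice_of_isNewformOf hf)
  -- characters over `ℚ̄`, embedded into `ℂ` and `ℂ_p`
  let K := AlgebraicClosure ℚ
  let σ : K →+* ℂ := (@IsAlgClosed.lift ℂ _ _ ℚ _ _ K _ _ (AlgebraicClosure.instAlgebra ℚ) _ _ _
    (AlgebraicClosure.isAlgebraic ℚ)).toRingHom
  let τ : K →+* ℂ_[p] := (@IsAlgClosed.lift ℂ_[p] _ _ ℚ _ _ K _ _
    (AlgebraicClosure.instAlgebra ℚ) _ _ _ (AlgebraicClosure.isAlgebraic ℚ)).toRingHom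
  have hψ : ∀ i : ℕ, ∃ ψ : DirichletCharacter K (p ^ (2 * i + a + 3)),
      ψ.IsPrimitive ∧ ψ.Even ∧ ∃ j : ℕ, orderOf ψ = p ^ j := fun i ↦ by
    haveI : NeZero ((Nat.totient (p ^ (2 * i + a + 3)) : ℕ) : ℚ) :=
      ⟨Nat.cast_ne_zero.mpr (Nat.totient_pos.mpr (pow_pos hp.pos _)).ne'⟩
    exact exists_isPrimitive_even_orderOf_eq_prime_pow K (2 * i + a)
  choose ψ hψprim hψeven hψord using hψ
  -- over `ℂ`, `L(f, (σψ_i)⁻¹, 1) = 0` for every `i`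
  have hbad : ∀ i : ℕ, (⟨p ^ (2 * i + a + 3), ((ψ i).ringHomComp σ)⁻¹⟩ :
      Σ m : ℕ, DirichletCharacter ℂ m) ∈
      {χ : Σ m : ℕ, DirichletCharacter ℂ m |
        χ.1 ≠ 0 ∧ χ.1.primeFactors ⊆ {p} ∧ χ.2.IsPrimitive ∧
          ∃ L : ℂ → ℂ, Differentiable ℂ L ∧
            (∀ s : ℂ, 2 < s.re → L s = twistedLSeries f χ.2 s) ∧ L 1 = 0} := by
    intro i
    haveI : NeZero (p ^ (2 * i + a + 3)) := ⟨pow_ne_zero _ hp.ne_zero⟩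
    have hprimC : DirichletCharacter.IsPrimitive ((ψ i).ringHomComp σ) :=
      (isPrimitive_ringHomComp_iff σ (ψ i)).mpr (hψprim i)
    refine ⟨pow_ne_zero _ hp.ne_zero, (Nat.primeFactors_prime_pow (by omega) hp).le, ?_, ?_⟩
    · rw [DirichletCharacter.isPrimitive_def, DirichletCharacter.conductor_inv]
      exact hprimC
    obtain ⟨L, hLd, hL⟩ := exists_differentiable_eq_twistedLSeries_holds f ((ψ i).ringHomComp σ)⁻¹
    refine ⟨L, hLd, hL, ?_⟩
    have hBirch := hB hf.1 hQ hprimC ((even_ringHomComp_iff σ (ψ i)).mpr (hψeven i)) hLd hL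
    have hzero : ratTwistedSymbolSum f ((ψ i).ringHomComp σ) = 0 := by
      have hτ : ratTwistedSymbolSum f ((ψ i).ringHomComp τ) = 0 :=
        hvan i _ ((isPrimitive_ringHomComp_iff τ (ψ i)).mpr (hψprim i))
          ((even_ringHomComp_iff τ (ψ i)).mpr (hψeven i))
          (by rw [orderOf_ringHomComp]; exact hψord i)
      rw [ratTwistedSymbolSum_ringHomComp, map_eq_zero] at hτ
      rw [ratTwistedSymbolSum_ringHomComp, hτ, map_zero]
    rw [hzero, zero_mul, eq_comm, mul_eq_zero] at hBirch
    exact hBirch.resolve_left (gaussSum_stdAddChar_ne_zero hprimC)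
  -- infinitely many distinct characters, contradicting Rohrlich
  let F : ℕ → Σ m : ℕ, DirichletCharacter ℂ m := fun i ↦
    ⟨p ^ (2 * i + a + 3), ((ψ i).ringHomComp σ)⁻¹⟩
  have hFinj : Function.Injective F := fun i l h ↦ by
    have h1 : p ^ (2 * i + a + 3) = p ^ (2 * l + a + 3) := congr_arg Sigma.fst h
    have := Nat.pow_right_injective hp.two_le h1
    omega
  have hfin : (Set.univ : Set ℕ).Finite := by
    refine (hR.preimage hFinj.injOn).subset fun i _ ↦ ?_
    exact hbad i
  exact Set.infinite_univ hfin

/-- **`L⁻ ≠ 0`**: a `Λ`-element with the even congruences is non-zero, for otherwise every Birch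
sum at a wild character of conductor `p^{2m+1}`, `m ≥ 1`, would vanish (Pollack 2003, Cor. 5.11,
from Rohrlich). [cite: Pollack2003, Cor. 5.11] -/
theorem ne_zero_of_isCongrModOmega_even (hp2 : p ≠ 2) (hf : IsNewformOf W f)
    (hgood : W.HasGoodReductionAtPrime p) {L : IwasawaAlgebra p}
    (hL : ∀ m : ℕ, IsCongrModOmega p (2 * m) (mazurTateElement f p (2 * m))
      ((-1) ^ (m + 1) * cyclotomicOmegaMinus p (2 * m)) L) : L ≠ 0 := by
  intro hL0
  subst hL0
  have he : cyclotomicExponent p = 1 := if_neg hp2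
  refine false_of_forall_ratTwistedSymbolSum_eq_zero hf hgood 0 fun i χ hχ hev hord ↦ ?_
  -- level `p^{2i+3} = p^{2(i+1) + e₀}`
  have hlev : ∀ (M : ℕ) (hM : M = 2 * (i + 1) + cyclotomicExponent p)
      (χ : DirichletCharacter ℂ_[p] (p ^ M)), χ.Even → (∃ j : ℕ, orderOf χ = p ^ j) →
      ratTwistedSymbolSum f χ = 0 := by
    intro M hM χ hev hord
    subst hM
    exact ratTwistedSymbolSum_eq_zero_of_isCongrModOmega_zero (hL (i + 1)) χ hev hord
  exact hlev (2 * i + 0 + 3) (by rw [he]; ring) χ hev hord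

/-- **`L⁺ ≠ 0`**, likewise from the odd congruences (conductors `p^{2m+2}`, `m ≥ 1`)
(Pollack 2003, Cor. 5.11). [cite: Pollack2003, Cor. 5.11] -/
theorem ne_zero_of_isCongrModOmega_odd (hp2 : p ≠ 2) (hf : IsNewformOf W f)
    (hgood : W.HasGoodReductionAtPrime p) {L : IwasawaAlgebra p}
    (hL : ∀ m : ℕ, IsCongrModOmega p (2 * m + 1) (mazurTateElement f p (2 * m + 1))
      ((-1) ^ (m + 1) * cyclotomicOmegaPlus p (2 * m + 1)) L) : L ≠ 0 := by
  intro hL0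
  subst hL0
  have he : cyclotomicExponent p = 1 := if_neg hp2
  refine false_of_forall_ratTwistedSymbolSum_eq_zero hf hgood 1 fun i χ hχ hev hord ↦ ?_
  have hlev : ∀ (M : ℕ) (hM : M = 2 * (i + 1) + 1 + cyclotomicExponent p)
      (χ : DirichletCharacter ℂ_[p] (p ^ M)), χ.Even → (∃ j : ℕ, orderOf χ = p ^ j) →
      ratTwistedSymbolSum f χ = 0 := by
    intro M hM χ hev hord
    subst hM
    exact ratTwistedSymbolSum_eq_zero_of_isCongrModOmega_zero (hL (i + 1)) χ hev hord
  exact hlev (2 * i + 1 + 3) (by rw [he]; ring) χ hev hord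

/-- **Pollack's plus/minus `p`-adic `L`-functions exist** — the named fact
`pollack_exists_plusMinusPAdicLFunction` (Pollack 2003, Thm. 5.6, Cor. 5.11, Prop. 6.18) is a
THEOREM of the tree: for `p` odd, `f` the newform of `E = W`, `E` with good reduction at `p` and
`a_p = 0`, there are `L⁺, L⁻ ∈ Λ = ℤ_p⟦T⟧`, both non-zero, with
`θ_n ≡ (-1)^{⌊n/2⌋+1} ω_n^+ L⁺ (mod ω_n)` (`n` odd) and `θ_n ≡ (-1)^{⌊n/2⌋+1} ω_n^- L⁻ (mod ω_n)`
(`n` even). Assembly: `p ∤ N` and `a_p(f) = a_p(E) = 0` (`not_dvd_level_of_isNewformOf`,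
`cuspCoeff_eq_frobeniusTrace_of_isNewformOf_holds`), existence by
`exists_isCongrModOmega_odd/even` (algebraic reconstruction from the Mazur–Tate elements, integral
by `norm_ratPlusSymbol_div_pow_le_one`), non-vanishing by `ne_zero_of_isCongrModOmega_odd/even`
(Rohrlich). Net effect: debt −1 (the fact is discharged; its users `…interpolation`,
`…hasSum_zero_of_ratTwistedSymbolSum_eq_zero`, `…finite_setOf_exists_ratTwistedSymbolSum_eq_zero`,
`Kobayashi2003.exists_isSignedPAdicLFunction`, `Kobayashi2003.existsUnique_isSignedPAdicLFunction`
become unconditional by feeding `pollack_exists_plusMinusPAdicLFunction_holds`).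
[cite: Pollack2003, Thm. 5.6, Cor. 5.11 and Prop. 6.18] -/
theorem pollack_exists_plusMinusPAdicLFunction_holds :
    pollack_exists_plusMinusPAdicLFunction (W := W) (f := f) (p := p) := by
  intro hp2 hf hgood hap
  have hf0 : IsNewform0 f := hf.1
  have hQ : coeffField f = ⊥ := hf.coeffField_eq_bot
  have hpN : ¬ p ∣ N := not_dvd_level_of_isNewformOf hf hgood
  have hap' : cuspCoeff f p = ((0 : ℤ) : ℂ) := by
    rw [cuspCoeff_eq_frobeniusTrace_of_isNewformOf_holds hf hgood, hap]
  obtain ⟨Lminus, hLminus⟩ := exists_isCongrModOmega_even hp2 hf0 hQ hpN hap'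
  obtain ⟨Lplus, hLplus⟩ := exists_isCongrModOmega_odd hp2 hf0 hQ hpN hap'
  refine ⟨Lplus, Lminus, ne_zero_of_isCongrModOmega_odd hp2 hf hgood hLplus,
    ne_zero_of_isCongrModOmega_even hp2 hf hgood hLminus, fun n hn ↦ ?_, fun n hn ↦ ?_⟩
  · obtain ⟨m, rfl⟩ := hn
    rw [show (2 * m + 1) / 2 + 1 = m + 1 by omega]
    exact hLplus m
  · obtain ⟨m, rfl⟩ := hn
    rw [show (m + m) / 2 + 1 = m + 1 by omega, ← two_mul]
    exact hLminus m

end NonVanishing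

end Literature.NumberTheory.EllipticCurves
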